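import Literature.MathematicalPhysics.QuantumFieldTheory.BalabanImbrieJaffe1984to88.BIJ88DeltaLocFlatClose235
import Literature.MathematicalPhysics.QuantumFieldTheory.BalabanImbrieJaffe1984to88.BIJ88ConvexWeights227
import Literature.MathematicalPhysics.QuantumFieldTheory.BalabanImbrieJaffe1984to88.BIJ88Cutoffs21

/-!
# `BalabanImbrieJaffe1984to88.BIJ88LocWeights227Torus` — T. Bałaban, J. Imbrie, A. Jaffe, *Effective action and cluster properties of
the abelian Higgs model*, Commun. Math. Phys. **114** (1988) 257–315 [BalabanImbrieJaffe1988], Sect. 2 p. 263 [PDF 7], (2.27) and (2.29):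
**THE PRINTED LOCALIZATION DATA `{□_α}`, `λ_α`, `ζ″` ON THE TORUS OF RECORD**, and (2.31)/(2.35)/(2.36) at flat backgrounds FOR THIS DATA —
the row hypotheses (i)–(iii) and the multiplicity `#S` of p31's `BIJ88NeumannPropagatorFlatClose231` / `BIJ88DeltaLocFlatClose235`
DISCHARGED by construction.

statement-level skeleton of published theorems with citation tags; proofs where landed; nothing here is a claim about the Yang–Mills mass gap

PDF held: `paper:balaban1988-cmp114-bij-abelian-higgs-effective-action` (journal page = PDF page + 256); p. 263 [PDF 7] re-read this session.

CITATION HEADER (lean-in-tree rule).  Part of the lit-balaban TYPED SKELETON (HOME `run/shared/lean/pub/lit-balaban/`), PHASE-2 proof seat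
p29 gen 26 (unit `lit-balaban-p29-g26`; TAKING line HOME/STATUS.md 2026-08-22T17:51:10Z; free-target protocol G.5-34(d) — item 2′ of the
owner's `HOME/lit-balaban-r18/C2S14-CLOSURE.md` v1.14d §5, *"the torus instance of the (2.27)/(2.29) data that discharges p31's row
hypotheses (i)–(iii)"*).  Rows **C2.Eq2.27**, **C2.Eq2.29** (DEF rows; decls of record p13's `BIJ88ConvexWeights227.cwt` on `ℤ^d` and
`BIJ88Cutoffs21.cutoff` for any distance) and the located members of **C2.Eq2.31**, **C2.Eq2.35**, **C2.Eq2.36** (heads «proved (p02)» =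
p02's abstract hence-steps; located flat-background members p31's `close231_flat_kernel_level`, `close235_flat_level`, `decay236_flat_level`,
which take the cube family, the weights and the cut-off as DATA with row hypotheses).  Owner r18, referee ref-5.  Kind: definitions with
body (the torus data) + theorems; no `Prop`-valued fact introduced; nothing of p13's / p31's files restated (used BY NAME).

THE PRINTED TEXT (verbatim, p. 263).  *"Let {□_α} be the collection of (1/2L) r(e_{k−1})-cubes that can be built from cubes of size M = O(1)
as in [6]. Define G̃_k(u; x₁, x₂) = Σ_α λ_αG_k(□_α, u; x₁, x₂) (2.27) as a convex combination of Neumann propagators. The convex combination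
varies smoothly with (x₁ + x₂)/2; it involves at most 2^d terms and is concentrated on □_α when (x₁ + x₂)/2 is near the center of □_α.
… where ζ″_k(x₁, x₂) is a smooth function of x₁ − x₂, ζ″_k(x₁, x₂) = 0, if |x₁ − x₂| ≧ (1/4L) r(e_{k−1}), 1, if |x₁ − x₂| ≦ (1/8L) r(e_{k−1}).
(2.29) … Hence |Δ_{k,loc}(u;x₁,x₂) − Δ_k(Ω,u;x₁,x₂)| ≦ e^{−cr(e_k)}e^{−c|x₁−x₂|} for dist({x₁,x₂},Ω^c) > O(r(e_k)), (2.35)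
|Δ_{k,loc}(u;x₁,x₂)| ≦ ce^{−c|x₁−x₂|}, (2.36)"*.

WHAT IS CONSTRUCTED (definitions with body).  On the fine torus `T^{(0)}` of record (`Balaban1983to89.Site P 0`), inside a no-wrap box
`Ω₀ = c·n + Π_i[0, n·M₀_i)` (p31's `cubeT hPd n c (n·M₀)`, `n = L^k`, chart `boxCoord` / `cubePt`):
* `lamT` — **the weights of (2.27) read through the chart**: `λ_α(x,y) = cwt s α (boxCoord x) (boxCoord y)` (p13's [6]-partition of
  unity at the midpoint, squared, cube spacing `s` lattice units) for `x, y ∈ Ω₀`, and `0` if either point is outside `Ω₀`;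
* `labels` — the finite label set `mlabels s (boxDom (n·M₀))` (p13: all candidate labels of all midpoints of the box);
* `cubeOf` — **the cube `□_α` of (2.27) as a union of `k`-blocks nested in `Ω₀`**: the chart box `{|z_i − sα_i| ≤ W}` rounded OUTWARD to
  `n`-blocks and clipped to `Ω₀` (`tLo`/`tHi` its block range), of p31's nested form `cubeT hPd n (c + t) (n·M)`, `t + M ≤ M₀`, `1 ≤ M`;
* the cut-off of (2.29) is p13's `cutoff R₁ R₀ (B5Ineq137Torus.T P 0)` — `1` within sup-torus distance `R₁`, `0` beyond `R₀` — used as is.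

WHAT IS PROVED (theorems only; 0 `sorry`; standard axioms).
* §1 torus-vs-chart geometry: `le_circAbs_of_le_abs` (`R ≤ |a| ≤ N − R ⇒ R ≤ dist(a, Nℤ)`), `abs_lt_of_circAbs_lt` (converse under the gap),
  `le_T_of_le_circAbs`, `circAbs_le_T`; **`le_T_of_far_coord`** (two points of `Ω₀` whose chart coordinates differ by `≥ R` in some direction are
  at sup-torus distance `≥ R`, given the torus gap `n·M₀_i + R ≤ |T^{(0)}|`); **`mem_and_abs_sub_le_of_T_le`** (a point at sup-torus distance
  `≤ D` from a point of `Ω₀` at chart depth `≥ D` lies in `Ω₀`, with chart coordinates within `D`).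
* §2 the data: `lamT_of_mem` / `lamT_of_not` / `lamT_nonneg` / `lamT_comm` / `mem_of_lamT_ne_zero`, `sum_abs_lamT_le_one` (**`Σ_α|λ_α| ≤ 1`**,
  p31's `hlam`), **`sum_lamT_eq_one`** (`Σ_α λ_α(x,y) = 1` for `x, y ∈ Ω₀` — p13's `sum_cwt`), `tLo_add_le` / `one_le_tHi_sub_tLo` /
  **`cubeOf_nested`** (p31's `hcube`) / `cubeOf_subset`, **`mem_cubeOf_of_abs_sub_le`** (a point of `Ω₀` within `W` of the centre `sα` in every
  chart coordinate lies in `□_α`) / `exists_lt_abs_sub_of_not_mem_cubeOf`, `abs_sub_center_lt_of_lamT_ne_zero` (an active weight puts both points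
  within `2s/3 + R₀/2` of the centre when their chart coordinates are within `R₀` — p13's `cwt_eq_zero_of_far`).
* §3 THE ROW HYPOTHESES DISCHARGED at every fine site `x ∈ Ω₀` of chart depth `≥ R₀`, for `W ≥ 2s/3 + R₀/2 + R` and the torus gap
  `n·M₀_i + R ≤ |T^{(0)}|`: **`rowHyp_i`** (`ζ″(x,y) ≠ 0 ⇒ Σ_αλ_α(x,y) = 1`), **`rowHyp_ii`** (`ζ″λ_α(x,y) ≠ 0 ⇒ x, y ∈ □_α` and every
  `w ∈ Ω₀ ∖ □_α` is at sup-torus distance `≥ R` from `x` and from `y`), **`rowHyp_iii`** (`|x−y|_T ≤ R₁ ⇒ ζ″ = 1`, p13's `isCutoff_cutoff`);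
  `cutoff_eq_zero_of_le` / `cutoff_mem_unitInterval` (support and range of the cut-off); block form `val_bounds_of_mem_blockK` /
  **`mem_and_depth_of_mem_blockK`** (every fine site of a `k`-block deep inside `Ω₀` lies in `Ω₀` at the same chart depth).
* §4 THE MULTIPLICITY: `labelBox` / `mem_labelBox_of_mem_cand` / `card_labelBox_le` (a box of labels holds `≤ (⌊ℓ/m⌋ + 3)^{d+1}` labels),
  `blockBase`, **`activeLabels`** (the labels that can be active on the rows of one `k`-block) with `mem_activeLabels_of_mem_cand`,
  **`mem_activeLabels_of_ne_zero`** (torus gap `≥ R₀`, any block) / **`mem_activeLabels_of_ne_zero_of_deep`** (deep blocks, no gap) and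
  **`card_activeLabels_le`**: `#S ≤ (⌊(n − 1 + R₀)/s⌋ + 3)^{d+1}`, **`= 3^{d+1}` for `s ≥ n + R₀`** (`card_activeLabels_le_three_pow`) — print's
  *"at most 2^d terms"* per point, summed over the rows of a block and a cut-off range.
* §5 THE CONSEQUENCES FOR THIS DATA at `u = 1^h` (p31's theorems BY NAME, their DATA hypotheses discharged by §2–§4; the families
  `cubeFam` / `lamFam` index `cubeOf` / `lamT` by the label set; `cubeFam_nested`, `cubeFam_fits`, `card_subtype_activeLabels_le`):
  **`close231_flat_kernel_cwt`** ((2.31) kernel at every deep `x`), **`close235_flat_cwt`** ((2.35) on every `k`-block deep inside `Ω₀`, with the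
  explicit multiplicity), **`decay236_flat_cwt`** ((2.36), every pair of blocks, explicit multiplicity, torus gap `≥ R₀`) — constants `δ₀, c₀` from
  `(d, ℓ, a)` only, the right-hand sides being p31's with `#S` replaced by `(⌊(L^k − 1 + R₀)/s⌋ + 3)^{d+1}`.
HONEST SCOPE.  (a) The cube half-width `W`, the grid spacing `s` and the radii `R, R₀, R₁` are free parameters subject to the displayed
inequalities; the printed assignment (cubes of side `(1/2L)r(e_{k−1})`, `ζ″` radii `(1/8L)r(e_{k−1}) < (1/4L)r(e_{k−1})`, all in units of the
`k`-lattice, i.e. `×L^k` fine bonds) is ONE admissible choice, recorded here, not hard-wired.  (b) `Ω` = a no-wrap box `Ω₀` leaving a torus gap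
`≥ max(R, R₀)` (p31's HONEST SCOPE (ii) plus the gap, which makes «outside `□_α` in the chart» imply «far on the torus»).  (c) The printed
*"dist({x₁,x₂},Ω^c) > O(r(e_k))"* is the explicit chart-depth hypothesis on the block of `y₁`.  (d) Flat backgrounds only (p31's (i)).
(e) `lamT` is the squared-partition weight of p13 (Lipschitz profile standing in for `C^∞`, see `B4Sect5CubeBounds`); smoothness is not used here.
* §6 (v1.1, APPEND-ONLY) NON-VACUITY: **`close235_flat_cwt_instance`** — every hypothesis of `close235_flat_cwt` met at once on the genuine
  `Setup` torus `ℤ/162` (`d = 1`, `L = 3`, `m = 1`, `K = 3`; `k = 1`, `Ω₀ = [0,12)`, `s = 1`, `W = 2`, `R = 0`, `R₁ = 0`, `R₀ = 1`, `y₁ = 1 ∈ ℤ/54`),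
  so the (2.35) bound holds there for every pure gauge `h` and every `y₂` (multiplicity `6`).
* §7 (v1.2, APPEND-ONLY) THE REMAINING FLAT-BACKGROUND MEMBERS FOR THE DATA: **`decay_gTilde_flat_kernel_cwt`** / **`decay_gLocT_flat_kernel_cwt`**
  (kernel decay of (2.27)/(2.28), all `x, y`), **`opDecay230_flat_cwt`** ((2.30) operator form at every fine row `x`, torus gap `≥ R₀`, multiplicity
  `(⌊(L^k − 1 + R₀)/s⌋ + 3)^{d+1}` for the block of `x`), **`opClose231_flat_cwt`** ((2.31) operator form at every deep row `x`) — p31's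
  `decay_gTilde_flat_kernel_level` / `decay_gLocT_flat_kernel_level` / `opDecay230_flat_level` / `opClose231_flat_level` BY NAME.
Imports: p31 `BIJ88DeltaLocFlatClose235` (→ `…FlatClose231`, `…FlatDecayCube`), p13 `BIJ88ConvexWeights227`, `BIJ88Cutoffs21`.
Literature + Mathlib only.  Unit `lit-balaban-p29` (literature-prover-lit-balaban-p29-g26-0), 2026-08-22; v1 = p337115 (ACCEPTED fd13fd4c1edc),
v1.1 = APPEND-ONLY §6 (p337593, ACCEPTED a86bf3d09fb3), v1.2 = APPEND-ONLY §7 (unit `lit-balaban-p29-g27`, literature-prover-lit-balaban-p29-g27-0;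
everything before §7 byte-identical to v1.1 except this docstring).  NOT summit progress.
-/

open scoped BigOperators Matrix ComplexConjugate
open Finset Matrix

namespace Literature.MathematicalPhysics.QuantumFieldTheory.BalabanImbrieJaffe1984to88.BIJ88LocWeights227Torus

open Literature.MathematicalPhysics.QuantumFieldTheory.Balaban1983to89
open BIJ88Sect3Statements (U1)
open BIJ85BlockAveragesTorus BIJ85BlockAveragesTorusK
open BIJ85BlockKPoincare (val_blkIter sitesPerDir_eq_mul_pow)
open BIJ88NeumannPropagator227Torus (gBox)
open BIJ88DeltaLoc234Torus (gLocT deltaLocT deltaRegion)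
open BIJ88NeumannPropagatorFlatDecayCube
open BIJ88NeumannPropagatorFlatClose231
open BIJ88DeltaLocFlatClose235
open BIJ88ConvexWeights227 (cwt cwt_nonneg cwt_le_one sum_cwt cwt_eq_zero_of_far cwt_comm mlabels cand_subset_mlabels)
open BIJ88Cutoffs21 (cutoff cutoff_nonneg cutoff_le_one isCutoff_cutoff)
open B4Sect5CubeBounds (cand)
open B4Reflection242 (boxDom mem_boxDom)
open B4TorusKernel.MultiPeriod (circAbs centre circAbs_add_mul circAbs_le_abs abs_add_mul_centre circAbs_nonneg)
open GaugeField (gaugeAct)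

noncomputable section

variable {d : ℕ} {P : Params}

/-! ## §1 Torus distance versus chart coordinates inside a no-wrap box -/

section TorusChart

/-- kernel: **far in `ℤ` and away from the period ⇒ far on `ℤ/N`**: `R ≤ |a|` and `|a| + R ≤ N` give `R ≤ dist(a, Nℤ)` (the centred
representative `a + N·m` is `a` itself when `m = 0`, and has modulus `≥ N − |a|` otherwise) — bookkeeping for the torus distance
`|x − y| = max_μ min{|x_μ − y_μ|, 2L_μ − |x_μ − y_μ|}`. [cite: Balaban1982Higgs1, (1.3) p.604, dictionary] -/
theorem le_circAbs_of_le_abs {N : ℕ} (hN : 1 ≤ N) {a : ℤ} {R : ℝ} (h1 : R ≤ (|a| : ℤ)) (h2 : ((|a| : ℤ) : ℝ) + R ≤ N) :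
    R ≤ (circAbs N a : ℝ) := by
  have hc := abs_add_mul_centre hN a
  set m := centre N a with hm
  rw [← hc]
  by_cases hm0 : m = 0
  · rw [hm0, mul_zero, add_zero]; exact h1
  · have hm1 : 1 ≤ |m| := Int.one_le_abs hm0
    have hN0 : (0 : ℤ) ≤ N := Int.natCast_nonneg _
    have key : (N : ℤ) - |a| ≤ |a + N * m| := by
      have h3 : |(N : ℤ) * m| = N * |m| := by rw [abs_mul, abs_of_nonneg hN0]
      have h4 : (N : ℤ) ≤ N * |m| := by nlinarith
      have h5 := abs_sub_abs_le_abs_sub ((N : ℤ) * m) (-a)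
      rw [abs_neg, sub_neg_eq_add, add_comm] at h5
      linarith
    have key' : ((N : ℤ) : ℝ) - ((|a| : ℤ) : ℝ) ≤ ((|a + N * m| : ℤ) : ℝ) := by exact_mod_cast key
    push_cast at key' h2 ⊢
    linarith

/-- kernel: **close on `ℤ/N` and away from the period ⇒ close in `ℤ`**: `dist(a, Nℤ) < R` and `|a| + R ≤ N` give `|a| < R`.
[cite: Balaban1982Higgs1, (1.3) p.604, dictionary] -/
theorem abs_lt_of_circAbs_lt {N : ℕ} (hN : 1 ≤ N) {a : ℤ} {R : ℝ} (h1 : (circAbs N a : ℝ) < R) (h2 : ((|a| : ℤ) : ℝ) + R ≤ N) :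
    ((|a| : ℤ) : ℝ) < R := by
  by_contra hge
  exact absurd (le_circAbs_of_le_abs hN (not_lt.mp hge) h2) (not_le.mpr h1)

/-- kernel: the sup torus distance of `T^{(0)}` (*"|x − y| = max_μ min{|x_μ − y_μ|, 2L_μ − |x_μ − y_μ|}"*) dominates every circular
coordinate distance. [cite: Balaban1982Higgs1, (1.3) p.604, dictionary] -/
theorem circAbs_le_T (x y : Balaban1983to89.Site P 0) (μ : Fin P.d) :
    (circAbs (P.sitesPerDir 0) (((x μ).val : ℤ) - ((y μ).val : ℤ)) : ℝ) ≤ B5Ineq137Torus.T P 0 x y :=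
  B4Sect5Torus.circAbs_le_tdist (B5Ineq137Torus.Nv_pos P 0) (B5Ineq137Torus.toT x) (B5Ineq137Torus.toT y) μ

/-- kernel: a lower bound on one circular coordinate distance is a lower bound on the sup torus distance.
[cite: Balaban1982Higgs1, (1.3) p.604, dictionary] -/
theorem le_T_of_le_circAbs {x y : Balaban1983to89.Site P 0} {μ : Fin P.d} {R : ℝ}
    (h : R ≤ (circAbs (P.sitesPerDir 0) (((x μ).val : ℤ) - ((y μ).val : ℤ)) : ℝ)) : R ≤ B5Ineq137Torus.T P 0 x y :=
  h.trans (circAbs_le_T x y μ)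

variable (hPd : P.d = d + 1) {n : ℕ} {c M0 : Fin (d + 1) → ℕ}

/-- kernel: `Fin.cast` round trip. [folklore] -/
private theorem cast_cast (i : Fin (d + 1)) : Fin.cast hPd (Fin.cast hPd.symm i) = i := by
  ext; rfl

/-- kernel: `Fin.cast` round trip, other direction. [folklore] -/
private theorem cast_cast' (μ : Fin P.d) : Fin.cast hPd.symm (Fin.cast hPd μ) = μ := by
  ext; rfl

/-- kernel: the chart coordinates of a point of the box `Ω₀ = c·n + Π_i[0, n·M₀_i)` lie in `[0, n·M₀_i)`. [cite: Balaban1983RegularityDecay, p.572, dictionary] -/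
theorem boxCoord_bounds (hfit : ∀ i, c i * n + n * M0 i ≤ P.sitesPerDir 0) {x : Balaban1983to89.Site P 0}
    (hx : x ∈ cubeT hPd n c fun i => n * M0 i) (i : Fin (d + 1)) :
    0 ≤ boxCoord hPd n c x i ∧ boxCoord hPd n c x i < n * M0 i :=
  (mem_boxDom.1 (cubePt_boxCoord hPd hfit hx).1) i

/-- kernel: the difference of chart coordinates is the difference of torus labels. [cite: Balaban1983RegularityDecay, p.572, dictionary] -/
theorem boxCoord_sub_boxCoord (x w : Balaban1983to89.Site P 0) (i : Fin (d + 1)) :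
    boxCoord hPd n c x i - boxCoord hPd n c w i = ((x (Fin.cast hPd.symm i)).val : ℤ) - ((w (Fin.cast hPd.symm i)).val : ℤ) := by
  simp only [boxCoord]; ring

/-- **Far in the chart ⇒ far on the torus.**  For two points `x, w` of the no-wrap box `Ω₀` whose chart coordinates differ by at least `R`
in some direction `i`, the sup torus distance is `≥ R` — provided the box leaves a torus gap of `R` in that direction (`n·M₀_i + R ≤ |T^{(0)}|`),
so that going around the torus is no shortcut. [cite: BalabanImbrieJaffe1988, (2.27) p.263, dictionary] -/
theorem le_T_of_far_coord (hfit : ∀ i, c i * n + n * M0 i ≤ P.sitesPerDir 0) {R : ℝ} {i : Fin (d + 1)}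
    (hgap : ((n * M0 i : ℕ) : ℝ) + R ≤ P.sitesPerDir 0) {x w : Balaban1983to89.Site P 0}
    (hx : x ∈ cubeT hPd n c fun i => n * M0 i) (hw : w ∈ cubeT hPd n c fun i => n * M0 i)
    (hfar : R ≤ ((|boxCoord hPd n c x i - boxCoord hPd n c w i| : ℤ) : ℝ)) : R ≤ B5Ineq137Torus.T P 0 x w := by
  have hN : 1 ≤ P.sitesPerDir 0 := (P.one_lt_sitesPerDir 0).le
  obtain ⟨hx0, hx1⟩ := boxCoord_bounds hPd hfit hx i
  obtain ⟨hw0, hw1⟩ := boxCoord_bounds hPd hfit hw i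
  have habs : |boxCoord hPd n c x i - boxCoord hPd n c w i| ≤ ((n * M0 i : ℕ) : ℤ) := by
    rw [abs_le]; constructor <;> push_cast <;> omega
  have habs' : ((|boxCoord hPd n c x i - boxCoord hPd n c w i| : ℤ) : ℝ) ≤ ((n * M0 i : ℕ) : ℝ) := by exact_mod_cast habs
  refine le_T_of_le_circAbs (μ := Fin.cast hPd.symm i) (le_circAbs_of_le_abs hN ?_ ?_)
  · rwa [← boxCoord_sub_boxCoord hPd]
  · rw [← boxCoord_sub_boxCoord hPd]; linarith

/-- **Close on the torus to a deep point of the box ⇒ in the box, close in the chart.**  If `x ∈ Ω₀` has chart depth `≥ D` (every chart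
coordinate in `[D, n·M₀_i − 1 − D]`; this forces `x ∈ Ω₀`) and `|x − y|_T ≤ D` (sup torus distance), then `y ∈ Ω₀` and every chart
coordinate of `y` is within `D` of that of `x`. [cite: BalabanImbrieJaffe1988, (2.27) p.263, dictionary] -/
theorem mem_and_abs_sub_le_of_T_le (hfit : ∀ i, c i * n + n * M0 i ≤ P.sitesPerDir 0) {D : ℝ} {x y : Balaban1983to89.Site P 0}
    (hdeep : ∀ i, D ≤ (boxCoord hPd n c x i : ℝ) ∧ (boxCoord hPd n c x i : ℝ) + D ≤ (n * M0 i : ℕ) - 1)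
    (hT : B5Ineq137Torus.T P 0 x y ≤ D) :
    y ∈ (cubeT hPd n c fun i => n * M0 i) ∧ ∀ i, ((|boxCoord hPd n c x i - boxCoord hPd n c y i| : ℤ) : ℝ) ≤ D := by
  have hN : 1 ≤ P.sitesPerDir 0 := (P.one_lt_sitesPerDir 0).le
  -- coordinatewise: the label of `y` is the label of `x` minus the centred representative of their difference
  have key : ∀ μ : Fin P.d, ((y μ).val : ℤ) = (x μ).val - ((((x μ).val : ℤ) - (y μ).val) + P.sitesPerDir 0 * centre (P.sitesPerDir 0) (((x μ).val : ℤ) - (y μ).val)) ∧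
      ((|(((x μ).val : ℤ) - (y μ).val) + P.sitesPerDir 0 * centre (P.sitesPerDir 0) (((x μ).val : ℤ) - (y μ).val)| : ℤ) : ℝ) ≤ D := by
    intro μ
    set a : ℤ := ((x μ).val : ℤ) - (y μ).val with ha
    set m : ℤ := centre (P.sitesPerDir 0) a with hm
    have hδ : |a + P.sitesPerDir 0 * m| = circAbs (P.sitesPerDir 0) a := abs_add_mul_centre hN a
    have hδD : ((|a + P.sitesPerDir 0 * m| : ℤ) : ℝ) ≤ D := by
      rw [hδ]; exact (circAbs_le_T x y μ).trans hT
    refine ⟨?_, hδD⟩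
    -- both `(y μ).val` and `(x μ).val − δ` lie in `[0, N)` and are congruent mod `N`
    set i := Fin.cast hPd μ with hi
    have hxi := hdeep i
    have hbx : (boxCoord hPd n c x i : ℝ) = ((x μ).val : ℝ) - ((c i * n : ℕ) : ℝ) := by
      simp only [boxCoord, hi, cast_cast']; push_cast; ring
    have hfi := hfit i
    have hyv0 : 0 ≤ ((y μ).val : ℤ) := Int.natCast_nonneg _
    have hyv1 : ((y μ).val : ℤ) < P.sitesPerDir 0 := by exact_mod_cast ZMod.val_lt (y μ)
    have hδabs : ((|a + P.sitesPerDir 0 * m| : ℤ) : ℝ) = |((a + P.sitesPerDir 0 * m : ℤ) : ℝ)| := by push_cast; rfl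
    rw [hδabs] at hδD
    have hlo : (0 : ℝ) ≤ ((x μ).val : ℝ) - ((a + P.sitesPerDir 0 * m : ℤ) : ℝ) := by
      have := neg_abs_le ((a + P.sitesPerDir 0 * m : ℤ) : ℝ)
      have h' := abs_le.1 (show |((a + P.sitesPerDir 0 * m : ℤ) : ℝ)| ≤ D from hδD)
      have hc0 : (0 : ℝ) ≤ ((c i * n : ℕ) : ℝ) := Nat.cast_nonneg _
      linarith [hxi.1]
    have hhi : ((x μ).val : ℝ) - ((a + P.sitesPerDir 0 * m : ℤ) : ℝ) < P.sitesPerDir 0 := by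
      have h' := abs_le.1 (show |((a + P.sitesPerDir 0 * m : ℤ) : ℝ)| ≤ D from hδD)
      have hfi' : ((c i * n : ℕ) : ℝ) + ((n * M0 i : ℕ) : ℝ) ≤ P.sitesPerDir 0 := by exact_mod_cast hfi
      linarith [hxi.2]
    -- `(y μ).val = (x μ).val − δ + N·m'` with `m' = -m`... directly: `(y μ).val − ((x μ).val − δ) = N·m`
    have hcong : ((y μ).val : ℤ) - ((x μ).val - (a + P.sitesPerDir 0 * m)) = P.sitesPerDir 0 * m := by rw [ha]; ring
    have hlo' : (0 : ℤ) ≤ (x μ).val - (a + P.sitesPerDir 0 * m) := by exact_mod_cast hlo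
    have hhi' : ((x μ).val : ℤ) - (a + P.sitesPerDir 0 * m) < P.sitesPerDir 0 := by exact_mod_cast hhi
    have hm0 : m = 0 := by
      have hN0 : (0 : ℤ) < P.sitesPerDir 0 := by exact_mod_cast hN
      have h1 : -(P.sitesPerDir 0 : ℤ) < P.sitesPerDir 0 * m := by rw [← hcong]; omega
      have h2 : (P.sitesPerDir 0 : ℤ) * m < P.sitesPerDir 0 := by rw [← hcong]; omega
      have h3 : -1 < m := by
        by_contra h; push Not at h; nlinarith
      have h4 : m < 1 := by
        by_contra h; push Not at h; nlinarith
      omega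
    rw [hm0, mul_zero, add_zero, ha]
    ring
  constructor
  · rw [mem_cubeT_iff_val hPd hfit]
    intro μ
    obtain ⟨hk, hδD⟩ := key μ
    set i := Fin.cast hPd μ with hi
    have hxi := hdeep i
    have hbx : (boxCoord hPd n c x i : ℝ) = ((x μ).val : ℝ) - ((c i * n : ℕ) : ℝ) := by
      simp only [boxCoord, hi, cast_cast']; push_cast; ring
    have h' := abs_le.1 (show |(((((x μ).val : ℤ) - (y μ).val) + P.sitesPerDir 0 * centre (P.sitesPerDir 0) (((x μ).val : ℤ) - (y μ).val) : ℤ) : ℝ)| ≤ D by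
      have := hδD; push_cast at this ⊢; exact this)
    have hk' : ((y μ).val : ℝ) = ((x μ).val : ℝ) - (((((x μ).val : ℤ) - (y μ).val) + P.sitesPerDir 0 * centre (P.sitesPerDir 0) (((x μ).val : ℤ) - (y μ).val) : ℤ) : ℝ) := by
      exact_mod_cast hk
    have h1 : ((c i * n : ℕ) : ℝ) ≤ ((y μ).val : ℝ) := by linarith [hxi.1]
    have h2 : ((y μ).val : ℝ) < ((c i * n : ℕ) : ℝ) + ((n * M0 i : ℕ) : ℝ) := by linarith [hxi.2]
    exact ⟨by exact_mod_cast h1, by exact_mod_cast h2⟩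
  · intro i
    obtain ⟨hk, hδD⟩ := key (Fin.cast hPd.symm i)
    rw [boxCoord_sub_boxCoord hPd]
    have e : ((x (Fin.cast hPd.symm i)).val : ℤ) - ((y (Fin.cast hPd.symm i)).val : ℤ) =
        (((x (Fin.cast hPd.symm i)).val : ℤ) - (y (Fin.cast hPd.symm i)).val) +
          P.sitesPerDir 0 * centre (P.sitesPerDir 0) (((x (Fin.cast hPd.symm i)).val : ℤ) - (y (Fin.cast hPd.symm i)).val) := by
      omega
    rw [e]; exact hδD

end TorusChart

/-! ## §2 The data of (2.27) on the torus of record: chart weights `λ_α`, labels, block-aligned cubes `□_α` nested in `Ω₀` -/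

section Data

variable (hPd : P.d = d + 1) (n : ℕ) (c M0 : Fin (d + 1) → ℕ) (s : ℕ)

/-- **The weights `λ_α(x, y)` of (2.27) on the fine torus `T^{(0)}`** (labels `α ∈ ℤ^{d+1}`, cube spacing `s` fine bonds): inside the box
`Ω₀ = c·n + Π_i[0, n·M₀_i)` they are p13's [6]-weights `cwt s α` of the chart coordinates (*"varies smoothly with (x₁+x₂)/2 … concentrated
on □_α when (x₁+x₂)/2 is near the center of □_α"*), and `0` if either point lies outside `Ω₀`. [cite: BalabanImbrieJaffe1988, (2.27) p.263] -/
def lamT (α : Fin (d + 1) → ℤ) (x y : Balaban1983to89.Site P 0) : ℝ :=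
  if x ∈ (cubeT hPd n c fun i => n * M0 i) ∧ y ∈ (cubeT hPd n c fun i => n * M0 i) then
    cwt s α (boxCoord hPd n c x) (boxCoord hPd n c y) else 0

/-- **The label set** serving the box `Ω₀`: all candidate labels of all midpoints of chart points (p13's `mlabels`); finite, and every label
carrying a nonzero weight somewhere in `Ω₀ × Ω₀` belongs to it. [cite: BalabanImbrieJaffe1988, (2.27) p.263] -/
def labels : Finset (Fin (d + 1) → ℤ) := mlabels s (boxDom fun i => n * M0 i)

variable (W : ℕ)

/-- the first `n`-block (relative to the corner `c`) of the cube `□_α` in direction `i`: the block containing the chart coordinate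
`max(0, sα_i − W)`, clipped to `[0, M₀_i − 1]`. [cite: BalabanImbrieJaffe1988, (2.27) p.263] -/
def tLo (α : Fin (d + 1) → ℤ) : Fin (d + 1) → ℕ := fun i => min (M0 i - 1) (((s : ℤ) * α i - W).toNat / n)

/-- one past the last `n`-block of the cube `□_α` in direction `i`: the block after the one containing the chart coordinate `max(0, sα_i + W)`,
clipped to `M₀_i`. [cite: BalabanImbrieJaffe1988, (2.27) p.263] -/
def tHi (α : Fin (d + 1) → ℤ) : Fin (d + 1) → ℕ := fun i => min (M0 i) (((s : ℤ) * α i + W).toNat / n + 1)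

/-- **The cube `□_α` of (2.27) on the torus of record** (*"the collection of … cubes that can be built from cubes of size M = O(1) as in
[6]"*, here built from `k`-blocks, `n = L^k`): the chart box `{z : |z_i − sα_i| ≤ W ∀ i}` rounded OUTWARD to whole `n`-blocks and clipped to
`Ω₀` — the union of the blocks `[tLo_i, tHi_i)` (relative to the corner `c`) in every direction, in p31's nested form `cubeT hPd n (c + t) (n·M)`.
(For a label whose chart box does not meet `Ω₀` the value is an irrelevant clipped box: such a label carries no weight on `Ω₀ × Ω₀`.)
[cite: BalabanImbrieJaffe1988, (2.27) p.263] -/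
def cubeOf (α : Fin (d + 1) → ℤ) : Finset (Balaban1983to89.Site P 0) :=
  cubeT hPd n (c + tLo n M0 s W α) fun i => n * (tHi n M0 s W α i - tLo n M0 s W α i)

variable {hPd n c M0 s W}

/-- the weights vanish unless both points lie in `Ω₀`. [cite: BalabanImbrieJaffe1988, (2.27) p.263] -/
theorem lamT_of_not (α : Fin (d + 1) → ℤ) {x y : Balaban1983to89.Site P 0}
    (h : ¬(x ∈ (cubeT hPd n c fun i => n * M0 i) ∧ y ∈ (cubeT hPd n c fun i => n * M0 i))) : lamT hPd n c M0 s α x y = 0 := by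
  rw [lamT, if_neg h]

/-- inside `Ω₀` the weights are p13's chart weights. [cite: BalabanImbrieJaffe1988, (2.27) p.263] -/
theorem lamT_of_mem (α : Fin (d + 1) → ℤ) {x y : Balaban1983to89.Site P 0} (hx : x ∈ (cubeT hPd n c fun i => n * M0 i))
    (hy : y ∈ (cubeT hPd n c fun i => n * M0 i)) : lamT hPd n c M0 s α x y = cwt s α (boxCoord hPd n c x) (boxCoord hPd n c y) := by
  rw [lamT, if_pos ⟨hx, hy⟩]

/-- `0 ≤ λ_α`. [cite: BalabanImbrieJaffe1988, (2.27) p.263] -/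
theorem lamT_nonneg (α : Fin (d + 1) → ℤ) (x y : Balaban1983to89.Site P 0) : 0 ≤ lamT hPd n c M0 s α x y := by
  unfold lamT
  split_ifs
  · exact cwt_nonneg _ _ _ _
  · exact le_rfl

/-- a nonzero weight forces both points into `Ω₀`. [cite: BalabanImbrieJaffe1988, (2.27) p.263] -/
theorem mem_of_lamT_ne_zero {α : Fin (d + 1) → ℤ} {x y : Balaban1983to89.Site P 0} (h : lamT hPd n c M0 s α x y ≠ 0) :
    x ∈ (cubeT hPd n c fun i => n * M0 i) ∧ y ∈ (cubeT hPd n c fun i => n * M0 i) := by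
  by_contra hn
  exact h (lamT_of_not α hn)

/-- the weights are symmetric in `(x, y)` (functions of the midpoint). [cite: BalabanImbrieJaffe1988, (2.27) p.263] -/
theorem lamT_comm (α : Fin (d + 1) → ℤ) (x y : Balaban1983to89.Site P 0) : lamT hPd n c M0 s α x y = lamT hPd n c M0 s α y x := by
  unfold lamT
  rw [cwt_comm]
  by_cases h : x ∈ (cubeT hPd n c fun i => n * M0 i) ∧ y ∈ (cubeT hPd n c fun i => n * M0 i)
  · rw [if_pos h, if_pos (And.comm.1 h)]
  · rw [if_neg h, if_neg (fun h' => h (And.comm.1 h'))]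

/-- **`Σ_α λ_α(x, y) = 1` for `x, y ∈ Ω₀`** (*"a convex combination"*; p13's `sum_cwt` over the label set `labels`, which contains the `2^{d+1}`
candidate labels of every midpoint of the box). [cite: BalabanImbrieJaffe1988, (2.27) p.263] -/
theorem sum_lamT_eq_one (hfit : ∀ i, c i * n + n * M0 i ≤ P.sitesPerDir 0) {x y : Balaban1983to89.Site P 0}
    (hx : x ∈ (cubeT hPd n c fun i => n * M0 i)) (hy : y ∈ (cubeT hPd n c fun i => n * M0 i)) :
    ∑ α : ↥(labels n M0 s), lamT hPd n c M0 s α.1 x y = 1 := by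
  simp_rw [lamT_of_mem _ hx hy]
  rw [Finset.sum_coe_sort (labels n M0 s) (fun α => cwt s α (boxCoord hPd n c x) (boxCoord hPd n c y))]
  exact sum_cwt s _ _ _ (cand_subset_mlabels s (cubePt_boxCoord hPd hfit hx).1 (cubePt_boxCoord hPd hfit hy).1)

/-- **`Σ_α |λ_α(x, y)| ≤ 1` everywhere** (the data hypothesis `hlam` of p31's theorems): `= 1` inside `Ω₀`, `= 0` outside.
[cite: BalabanImbrieJaffe1988, (2.27) p.263] -/
theorem sum_abs_lamT_le_one (hfit : ∀ i, c i * n + n * M0 i ≤ P.sitesPerDir 0) (x y : Balaban1983to89.Site P 0) :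
    ∑ α : ↥(labels n M0 s), |lamT hPd n c M0 s α.1 x y| ≤ 1 := by
  simp_rw [abs_of_nonneg (lamT_nonneg _ _ _)]
  by_cases h : x ∈ (cubeT hPd n c fun i => n * M0 i) ∧ y ∈ (cubeT hPd n c fun i => n * M0 i)
  · exact (sum_lamT_eq_one hfit h.1 h.2).le
  · simp_rw [lamT_of_not _ h]
    rw [Finset.sum_const_zero]
    exact zero_le_one

/-- kernel: the lower block index is monotone material — `toNat(sα_i − W)/n ≤ toNat(sα_i + W)/n`. [folklore] -/
private theorem div_lo_le_div_hi (α : Fin (d + 1) → ℤ) (i : Fin (d + 1)) :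
    ((s : ℤ) * α i - W).toNat / n ≤ ((s : ℤ) * α i + W).toNat / n :=
  Nat.div_le_div_right (Int.toNat_le_toNat (by omega))

/-- the block range of `□_α` stays inside `[0, M₀_i]`: `tLo_i + (tHi_i − tLo_i) ≤ M₀_i` (the nesting `t + M ≤ M₀` of p31's `hcube`).
[cite: BalabanImbrieJaffe1988, (2.27) p.263] -/
theorem tLo_add_le (α : Fin (d + 1) → ℤ) (i : Fin (d + 1)) :
    tLo n M0 s W α i + (tHi n M0 s W α i - tLo n M0 s W α i) ≤ M0 i := by
  have h1 : tLo n M0 s W α i ≤ M0 i - 1 := min_le_left _ _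
  have h2 : tHi n M0 s W α i ≤ M0 i := min_le_left _ _
  omega

/-- every cube has at least one block in every direction: `1 ≤ tHi_i − tLo_i` (given `1 ≤ M₀_i`). [cite: BalabanImbrieJaffe1988, (2.27) p.263] -/
theorem one_le_tHi_sub_tLo (hM0 : ∀ i, 1 ≤ M0 i) (α : Fin (d + 1) → ℤ) (i : Fin (d + 1)) :
    1 ≤ tHi n M0 s W α i - tLo n M0 s W α i := by
  have h1 : tLo n M0 s W α i ≤ M0 i - 1 := min_le_left _ _
  have h2 : tLo n M0 s W α i ≤ ((s : ℤ) * α i - W).toNat / n := min_le_right _ _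
  have h3 := div_lo_le_div_hi (n := n) (s := s) (W := W) α i
  have h4 := hM0 i
  show 1 ≤ min (M0 i) (((s : ℤ) * α i + W).toNat / n + 1) - tLo n M0 s W α i
  rcases Nat.le_total (M0 i) (((s : ℤ) * α i + W).toNat / n + 1) with h | h
  · rw [min_eq_left h]; omega
  · rw [min_eq_right h]; omega

/-- **The cubes are unions of `k`-blocks nested in `Ω₀`** — the data hypothesis `hcube` of p31's theorems: `□_α = cubeT hPd n (c + t) (n·M)` with
`1 ≤ M_i`, `t_i + M_i ≤ M₀_i`. [cite: BalabanImbrieJaffe1988, (2.27) p.263] -/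
theorem cubeOf_nested (hM0 : ∀ i, 1 ≤ M0 i) (α : Fin (d + 1) → ℤ) :
    ∃ t M : Fin (d + 1) → ℕ, (∀ i, 1 ≤ M i) ∧ (∀ i, t i + M i ≤ M0 i) ∧
      cubeOf hPd n c M0 s W α = cubeT hPd n (c + t) fun i => n * M i :=
  ⟨tLo n M0 s W α, fun i => tHi n M0 s W α i - tLo n M0 s W α i, one_le_tHi_sub_tLo hM0 α, tLo_add_le α, rfl⟩

/-- the cubes lie in `Ω₀`. [cite: BalabanImbrieJaffe1988, (2.27) p.263] -/
theorem cubeOf_subset (α : Fin (d + 1) → ℤ) : cubeOf hPd n c M0 s W α ⊆ cubeT hPd n c fun i => n * M0 i :=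
  cubeT_nested_subset hPd (tLo_add_le α)

/-- **A point of `Ω₀` within `W` of the centre `sα` in every chart coordinate lies in `□_α`** (the outward rounding to blocks only enlarges
the chart box). [cite: BalabanImbrieJaffe1988, (2.27) p.263] -/
theorem mem_cubeOf_of_abs_sub_le (hn : 1 ≤ n) (hfit : ∀ i, c i * n + n * M0 i ≤ P.sitesPerDir 0) (α : Fin (d + 1) → ℤ)
    {w : Balaban1983to89.Site P 0} (hw : w ∈ (cubeT hPd n c fun i => n * M0 i))
    (hnear : ∀ i, |boxCoord hPd n c w i - s * α i| ≤ W) : w ∈ cubeOf hPd n c M0 s W α := by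
  have hwv := (mem_cubeT_iff_val hPd hfit w).1 hw
  rw [cubeOf, mem_cubeT_iff_val hPd (fit_of_nested (tLo_add_le α) hfit)]
  intro μ
  obtain ⟨hv0, hv1⟩ := hwv μ
  set i := Fin.cast hPd μ with hi
  have hz : boxCoord hPd n c w i = ((w μ).val : ℤ) - ((c i * n : ℕ) : ℤ) := by
    simp only [boxCoord, hi, cast_cast']
  have hv0' : ((c i * n : ℕ) : ℤ) ≤ (w μ).val := by exact_mod_cast hv0
  have hv1' : ((w μ).val : ℤ) < ((c i * n : ℕ) : ℤ) + ((n * M0 i : ℕ) : ℤ) := by exact_mod_cast hv1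
  have hz0 : 0 ≤ boxCoord hPd n c w i := by rw [hz]; omega
  have hz1 : boxCoord hPd n c w i < ((n * M0 i : ℕ) : ℤ) := by rw [hz]; omega
  have hni : (0 : ℤ) < n := by exact_mod_cast hn
  have hnear' := abs_le.1 (hnear i)
  -- lower end: `tLo_i · n ≤ z_i`
  have hlo : ((tLo n M0 s W α i : ℕ) : ℤ) * n ≤ boxCoord hPd n c w i := by
    have h1 : tLo n M0 s W α i ≤ ((s : ℤ) * α i - W).toNat / n := min_le_right _ _
    have h2 : (((s : ℤ) * α i - W).toNat / n) * n ≤ ((s : ℤ) * α i - W).toNat := Nat.div_mul_le_self _ _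
    have h3 : ((((s : ℤ) * α i - W).toNat : ℕ) : ℤ) ≤ boxCoord hPd n c w i := by
      rcases le_or_gt 0 ((s : ℤ) * α i - W) with h | h
      · rw [Int.toNat_of_nonneg h]; linarith
      · rw [Int.toNat_eq_zero.2 h.le]; push_cast; exact hz0
    have h12 : ((tLo n M0 s W α i : ℕ) : ℤ) * n ≤ ((((s : ℤ) * α i - W).toNat : ℕ) : ℤ) := by
      have := Nat.mul_le_mul_right n h1
      exact_mod_cast this.trans h2
    exact h12.trans h3
  -- upper end: `z_i < tHi_i · n`
  have hhi : boxCoord hPd n c w i < ((tHi n M0 s W α i : ℕ) : ℤ) * n := by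
    have hA : boxCoord hPd n c w i < ((M0 i : ℕ) : ℤ) * n := by
      have : ((n * M0 i : ℕ) : ℤ) = ((M0 i : ℕ) : ℤ) * n := by push_cast; ring
      rw [← this]; exact hz1
    have hB : boxCoord hPd n c w i < (((((s : ℤ) * α i + W).toNat / n + 1 : ℕ) : ℤ)) * n := by
      have h0 : 0 ≤ (s : ℤ) * α i + W := by omega
      have h1 : boxCoord hPd n c w i ≤ ((((s : ℤ) * α i + W).toNat : ℕ) : ℤ) := by rw [Int.toNat_of_nonneg h0]; linarith
      have h2 : ((s : ℤ) * α i + W).toNat < (((s : ℤ) * α i + W).toNat / n + 1) * n := by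
        rw [Nat.add_mul, one_mul]; exact Nat.lt_div_mul_add hn
      have h2' : ((((s : ℤ) * α i + W).toNat : ℕ) : ℤ) < (((((s : ℤ) * α i + W).toNat / n + 1 : ℕ) : ℤ)) * n := by exact_mod_cast h2
      exact lt_of_le_of_lt h1 h2'
    show boxCoord hPd n c w i < ((min (M0 i) (((s : ℤ) * α i + W).toNat / n + 1) : ℕ) : ℤ) * n
    rw [Nat.cast_min, min_mul_of_nonneg _ _ hni.le]
    exact lt_min hA hB
  have hle : tLo n M0 s W α i ≤ tHi n M0 s W α i := by
    have := lt_of_le_of_lt hlo hhi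
    have h' : ((tLo n M0 s W α i : ℕ) : ℤ) < ((tHi n M0 s W α i : ℕ) : ℤ) := lt_of_mul_lt_mul_right this hni.le
    exact_mod_cast h'.le
  have e1 : (((c + tLo n M0 s W α) i * n : ℕ) : ℤ) = ((c i * n : ℕ) : ℤ) + ((tLo n M0 s W α i : ℕ) : ℤ) * n := by
    push_cast [Pi.add_apply]; ring
  have e2 : ((n * (tHi n M0 s W α i - tLo n M0 s W α i) : ℕ) : ℤ) = ((tHi n M0 s W α i : ℕ) : ℤ) * n - ((tLo n M0 s W α i : ℕ) : ℤ) * n := by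
    rw [Nat.cast_mul, Nat.cast_sub hle]; ring
  rw [hz] at hlo hhi
  constructor
  · have : (((c + tLo n M0 s W α) i * n : ℕ) : ℤ) ≤ ((w μ).val : ℤ) := by rw [e1]; linarith
    exact_mod_cast this
  · have : ((w μ).val : ℤ) < (((c + tLo n M0 s W α) i * n : ℕ) : ℤ) + ((n * (tHi n M0 s W α i - tLo n M0 s W α i) : ℕ) : ℤ) := by
      rw [e1, e2]; linarith
    exact_mod_cast this

/-- the contrapositive: a point of `Ω₀` outside `□_α` is more than `W` from the centre in some chart coordinate. [cite: BalabanImbrieJaffe1988, (2.27) p.263] -/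
theorem exists_lt_abs_sub_of_not_mem_cubeOf (hn : 1 ≤ n) (hfit : ∀ i, c i * n + n * M0 i ≤ P.sitesPerDir 0) (α : Fin (d + 1) → ℤ)
    {w : Balaban1983to89.Site P 0} (hw : w ∈ (cubeT hPd n c fun i => n * M0 i)) (hnot : w ∉ cubeOf hPd n c M0 s W α) :
    ∃ i, (W : ℤ) < |boxCoord hPd n c w i - s * α i| := by
  by_contra h
  push Not at h
  exact hnot (mem_cubeOf_of_abs_sub_le hn hfit α hw h)

/-- **An active weight localizes both points near the centre of its cube**: if `λ_α(x, y) ≠ 0` and the chart coordinates of `x, y` differ by at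
most `R₀` in direction `i`, then both are within `2s/3 + R₀/2` of `sα_i` (*"concentrated on □_α when (x₁+x₂)/2 is near the center of □_α"*:
p13's `cwt_eq_zero_of_far` — the midpoint is within `2s/3` of the centre). [cite: BalabanImbrieJaffe1988, (2.27) p.263] -/
theorem abs_sub_center_lt_of_lamT_ne_zero (hs : 0 < s) {α : Fin (d + 1) → ℤ} {x y : Balaban1983to89.Site P 0}
    (h : lamT hPd n c M0 s α x y ≠ 0) {i : Fin (d + 1)} {R₀ : ℝ}
    (hxy : ((|boxCoord hPd n c x i - boxCoord hPd n c y i| : ℤ) : ℝ) ≤ R₀) :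
    |(boxCoord hPd n c x i : ℝ) - s * α i| < 2 * s / 3 + R₀ / 2 ∧ |(boxCoord hPd n c y i : ℝ) - s * α i| < 2 * s / 3 + R₀ / 2 := by
  obtain ⟨hx, hy⟩ := mem_of_lamT_ne_zero h
  rw [lamT_of_mem α hx hy] at h
  have hmid : |(((boxCoord hPd n c x + boxCoord hPd n c y) i : ℤ) : ℝ) / 2 - s * α i| < 2 * s / 3 := by
    by_contra hge
    exact h (cwt_eq_zero_of_far hs (not_lt.1 hge))
  have hxy' : |(boxCoord hPd n c x i : ℝ) - (boxCoord hPd n c y i : ℝ)| ≤ R₀ := by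
    have : ((|boxCoord hPd n c x i - boxCoord hPd n c y i| : ℤ) : ℝ) = |(boxCoord hPd n c x i : ℝ) - (boxCoord hPd n c y i : ℝ)| := by push_cast; rfl
    rwa [this] at hxy
  rw [Pi.add_apply, Int.cast_add] at hmid
  set a := (boxCoord hPd n c x i : ℝ)
  set b := (boxCoord hPd n c y i : ℝ)
  set m := (s : ℝ) * α i
  have e1 : a - m = ((a + b) / 2 - m) + (a - b) / 2 := by ring
  have e2 : b - m = ((a + b) / 2 - m) - (a - b) / 2 := by ring
  have hh : |(a - b) / 2| ≤ R₀ / 2 := by rw [abs_div, abs_two]; linarith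
  constructor
  · rw [e1]; exact (abs_add_le _ _).trans_lt (by linarith)
  · rw [e2]; exact (abs_sub _ _).trans_lt (by linarith)

end Data

/-! ## §3 The row hypotheses (i)–(iii) of p31's (2.31)/(2.35) DISCHARGED at every fine site deep inside `Ω₀` -/

section RowHyps

variable (hPd : P.d = d + 1) {n : ℕ} {c M0 : Fin (d + 1) → ℕ} {s W : ℕ}

/-- **Row hypothesis (i)** of p31's `close231_flat_kernel_level` / `close235_flat_level` for the torus data: at a fine site `x ∈ Ω₀` of chart
depth `≥ R₀`, `ζ″(x, y) ≠ 0 ⇒ Σ_α λ_α(x, y) = 1` — for ANY cut-off `ζ″` vanishing beyond sup-torus distance `R₀` (the active `y` lies in `Ω₀`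
by `mem_and_abs_sub_le_of_T_le`, and there the weights are a convex combination). [cite: BalabanImbrieJaffe1988, (2.27) p.263] -/
theorem rowHyp_i (hfit : ∀ i, c i * n + n * M0 i ≤ P.sitesPerDir 0) {R₀ : ℝ}
    {ζ'' : Balaban1983to89.Site P 0 → Balaban1983to89.Site P 0 → ℝ} (hζ : ∀ x y, R₀ ≤ B5Ineq137Torus.T P 0 x y → ζ'' x y = 0)
    {x : Balaban1983to89.Site P 0} (hx : x ∈ (cubeT hPd n c fun i => n * M0 i))
    (hdeep : ∀ i, R₀ ≤ (boxCoord hPd n c x i : ℝ) ∧ (boxCoord hPd n c x i : ℝ) + R₀ ≤ (n * M0 i : ℕ) - 1) :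
    ∀ y, ζ'' x y ≠ 0 → ∑ α : ↥(labels n M0 s), lamT hPd n c M0 s α.1 x y = 1 := by
  intro y hy
  have hT : B5Ineq137Torus.T P 0 x y ≤ R₀ := le_of_lt (lt_of_not_ge fun h => hy (hζ x y h))
  exact sum_lamT_eq_one hfit hx (mem_and_abs_sub_le_of_T_le hPd hfit hdeep hT).1

/-- kernel: the cast of an integer absolute value. [folklore] -/
private theorem cast_abs_sub (a b : ℤ) : ((|a - b| : ℤ) : ℝ) = |(a : ℝ) - (b : ℝ)| := by
  push_cast; rfl

/-- **Row hypothesis (ii)** of p31's theorems for the torus data: at a fine site `x ∈ Ω₀` of chart depth `≥ R₀`, an active pair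
(`ζ″(x,y)λ_α(x,y) ≠ 0`) has `x, y ∈ □_α`, and every point of `Ω₀` outside `□_α` is at sup-torus distance `≥ R` from `x` and from `y` — given the
cube half-width `W ≥ 2s/3 + R₀/2 + R` and the torus gap `n·M₀_i + R ≤ |T^{(0)}|` (*"concentrated on □_α when (x₁+x₂)/2 is near the center
of □_α"* made quantitative). [cite: BalabanImbrieJaffe1988, (2.27) p.263] -/
theorem rowHyp_ii (hn : 1 ≤ n) (hs : 0 < s) (hfit : ∀ i, c i * n + n * M0 i ≤ P.sitesPerDir 0) {R R₀ : ℝ} (hR : 0 ≤ R)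
    (hgap : ∀ i, ((n * M0 i : ℕ) : ℝ) + R ≤ P.sitesPerDir 0) (hW : 2 * (s : ℝ) / 3 + R₀ / 2 + R ≤ W)
    {ζ'' : Balaban1983to89.Site P 0 → Balaban1983to89.Site P 0 → ℝ} (hζ : ∀ x y, R₀ ≤ B5Ineq137Torus.T P 0 x y → ζ'' x y = 0)
    {x : Balaban1983to89.Site P 0} (hx : x ∈ (cubeT hPd n c fun i => n * M0 i))
    (hdeep : ∀ i, R₀ ≤ (boxCoord hPd n c x i : ℝ) ∧ (boxCoord hPd n c x i : ℝ) + R₀ ≤ (n * M0 i : ℕ) - 1) :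
    ∀ (α : ↥(labels n M0 s)) (y : Balaban1983to89.Site P 0), ζ'' x y * lamT hPd n c M0 s α.1 x y ≠ 0 →
      x ∈ cubeOf hPd n c M0 s W α.1 ∧ y ∈ cubeOf hPd n c M0 s W α.1 ∧
        ∀ w ∈ (cubeT hPd n c fun i => n * M0 i), w ∉ cubeOf hPd n c M0 s W α.1 →
          R ≤ B5Ineq137Torus.T P 0 x w ∧ R ≤ B5Ineq137Torus.T P 0 y w := by
  intro α y hne
  have hζne : ζ'' x y ≠ 0 := left_ne_zero_of_mul hne
  have hlne : lamT hPd n c M0 s α.1 x y ≠ 0 := right_ne_zero_of_mul hne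
  have hT : B5Ineq137Torus.T P 0 x y ≤ R₀ := le_of_lt (lt_of_not_ge fun h => hζne (hζ x y h))
  obtain ⟨hy, hclose⟩ := mem_and_abs_sub_le_of_T_le hPd hfit hdeep hT
  have hnear : ∀ i, |(boxCoord hPd n c x i : ℝ) - s * α.1 i| < 2 * s / 3 + R₀ / 2 ∧
      |(boxCoord hPd n c y i : ℝ) - s * α.1 i| < 2 * s / 3 + R₀ / 2 := fun i =>
    abs_sub_center_lt_of_lamT_ne_zero hs hlne (hclose i)
  have hintW : ∀ {z : ℤ} {i : Fin (d + 1)}, |(z : ℝ) - s * α.1 i| < 2 * s / 3 + R₀ / 2 → |z - s * α.1 i| ≤ W := by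
    intro z i hz
    have : ((|z - s * α.1 i| : ℤ) : ℝ) ≤ W := by
      rw [cast_abs_sub]; push_cast; linarith
    exact_mod_cast this
  refine ⟨mem_cubeOf_of_abs_sub_le hn hfit _ hx fun i => hintW (hnear i).1,
    mem_cubeOf_of_abs_sub_le hn hfit _ hy fun i => hintW (hnear i).2, fun w hw hnot => ?_⟩
  obtain ⟨i, hi⟩ := exists_lt_abs_sub_of_not_mem_cubeOf hn hfit _ hw hnot
  have hi' : (W : ℝ) < |(boxCoord hPd n c w i : ℝ) - s * α.1 i| := by
    have : ((W : ℤ) : ℝ) < ((|boxCoord hPd n c w i - s * α.1 i| : ℤ) : ℝ) := by exact_mod_cast hi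
    rw [cast_abs_sub] at this; push_cast at this; exact this
  have far : ∀ {z : ℤ}, |(z : ℝ) - s * α.1 i| < 2 * s / 3 + R₀ / 2 → R ≤ ((|z - boxCoord hPd n c w i| : ℤ) : ℝ) := by
    intro z hz
    rw [cast_abs_sub]
    have h3 := abs_sub_abs_le_abs_sub ((boxCoord hPd n c w i : ℝ) - s * α.1 i) ((z : ℝ) - s * α.1 i)
    rw [show (boxCoord hPd n c w i : ℝ) - s * α.1 i - ((z : ℝ) - s * α.1 i) = -((z : ℝ) - boxCoord hPd n c w i) by ring, abs_neg] at h3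
    linarith
  exact ⟨le_T_of_far_coord hPd hfit (hgap i) hx hw (far (hnear i).1), le_T_of_far_coord hPd hfit (hgap i) hy hw (far (hnear i).2)⟩

/-- **Row hypothesis (iii)** for p13's cut-off of (2.29) on the torus: `|x − y|_T ≤ R₁ ⇒ ζ″(x, y) = 1` (p13's `isCutoff_cutoff`).
[cite: BalabanImbrieJaffe1988, (2.29) p.263] -/
theorem rowHyp_iii {R₁ R₀ : ℝ} (hR : R₁ < R₀) (x : Balaban1983to89.Site P 0) :
    ∀ y, B5Ineq137Torus.T P 0 x y ≤ R₁ → cutoff R₁ R₀ (B5Ineq137Torus.T P 0) x y = 1 :=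
  fun y hy => (isCutoff_cutoff hR (B5Ineq137Torus.T P 0)).1 x y hy

/-- the support half of p13's cut-off: `ζ″(x, y) = 0` beyond sup-torus distance `R₀`. [cite: BalabanImbrieJaffe1988, (2.29) p.263] -/
theorem cutoff_eq_zero_of_le {R₁ R₀ : ℝ} (hR : R₁ < R₀) :
    ∀ x y : Balaban1983to89.Site P 0, R₀ ≤ B5Ineq137Torus.T P 0 x y → cutoff R₁ R₀ (B5Ineq137Torus.T P 0) x y = 0 :=
  fun x y hxy => (isCutoff_cutoff hR (B5Ineq137Torus.T P 0)).2 x y hxy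

/-- `0 ≤ ζ″ ≤ 1` for p13's cut-off (the data hypothesis `hζ` of p31's theorems). [cite: BalabanImbrieJaffe1988, (2.29) p.263] -/
theorem cutoff_mem_unitInterval (R₁ R₀ : ℝ) (x y : Balaban1983to89.Site P 0) :
    0 ≤ cutoff R₁ R₀ (B5Ineq137Torus.T P 0) x y ∧ cutoff R₁ R₀ (B5Ineq137Torus.T P 0) x y ≤ 1 :=
  ⟨cutoff_nonneg _ _ _ _ _, cutoff_le_one _ _ _ _ _⟩

/-- kernel: **the labels of a fine site over its `k`-block site**: for `x ∈ B^k(y₁)`, `L^k·(y₁)_μ ≤ x_μ ≤ L^k·(y₁)_μ + L^k − 1` (labels read in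
`[0, |T|)`; p33's `val_blkIter`). [cite: BalabanImbrieJaffe1985, (2.4) p.302, dictionary] -/
theorem val_bounds_of_mem_blockK {k : ℕ} (hk : 0 + k ≤ P.m + P.K) {y₁ : Balaban1983to89.Site P (0 + k)}
    {x : Balaban1983to89.Site P 0} (hx : x ∈ blockK k y₁) (μ : Fin P.d) :
    (P.L : ℝ) ^ k * (y₁ μ).val ≤ (x μ).val ∧ ((x μ).val : ℝ) ≤ (P.L : ℝ) ^ k * (y₁ μ).val + (P.L : ℝ) ^ k - 1 := by
  have hn : 0 < P.L ^ k := pow_pos P.L_pos _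
  have hy₁ : blkIter k x = y₁ := mem_blockK.1 hx
  have e : (y₁ μ).val = (x μ).val / P.L ^ k := by rw [← hy₁, val_blkIter k hk x μ]
  have h1 : (x μ).val / P.L ^ k * P.L ^ k ≤ (x μ).val := Nat.div_mul_le_self _ _
  have h2 : (x μ).val < (x μ).val / P.L ^ k * P.L ^ k + P.L ^ k := Nat.lt_div_mul_add hn
  rw [← e] at h1 h2
  have hcast : ((P.L ^ k : ℕ) : ℝ) = (P.L : ℝ) ^ k := by push_cast; rfl
  constructor
  · have : (((y₁ μ).val * P.L ^ k : ℕ) : ℝ) ≤ (x μ).val := by exact_mod_cast h1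
    push_cast at this; linarith
  · have h2' : (x μ).val + 1 ≤ (y₁ μ).val * P.L ^ k + P.L ^ k := h2
    have : (((x μ).val + 1 : ℕ) : ℝ) ≤ (((y₁ μ).val * P.L ^ k + P.L ^ k : ℕ) : ℝ) := by exact_mod_cast h2'
    push_cast at this; linarith

/-- **Blocks deep inside `Ω₀`.**  If the `k`-block of `y₁ ∈ T^{(k)}` lies inside `Ω₀ = c·L^k + Π_i[0, L^k·M₀_i)` with chart margin `R₀ ≥ 0`
(`c_i·L^k + R₀ ≤ L^k·(y₁)_i` and `L^k·(y₁)_i + L^k + R₀ ≤ c_i·L^k + L^k·M₀_i`), then every fine site `x` of the block lies in `Ω₀` at chart depth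
`≥ R₀` — the printed *"dist({x₁,x₂},Ω^c) > O(r(e_k))"* of (2.35) for the block of `x₁`. [cite: BalabanImbrieJaffe1988, (2.35) p.263] -/
theorem mem_and_depth_of_mem_blockK {k : ℕ} (hk : 0 + k ≤ P.m + P.K) (hfit : ∀ i, c i * P.L ^ k + P.L ^ k * M0 i ≤ P.sitesPerDir 0)
    {R₀ : ℝ} (hR₀ : 0 ≤ R₀) {y₁ : Balaban1983to89.Site P (0 + k)}
    (hdeepB : ∀ μ, (c (Fin.cast hPd μ) : ℝ) * P.L ^ k + R₀ ≤ (P.L : ℝ) ^ k * (y₁ μ).val ∧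
      (P.L : ℝ) ^ k * (y₁ μ).val + P.L ^ k + R₀ ≤ (c (Fin.cast hPd μ) : ℝ) * P.L ^ k + (P.L : ℝ) ^ k * M0 (Fin.cast hPd μ))
    {x : Balaban1983to89.Site P 0} (hx : x ∈ blockK k y₁) :
    x ∈ (cubeT hPd (P.L ^ k) c fun i => P.L ^ k * M0 i) ∧
      ∀ i, R₀ ≤ (boxCoord hPd (P.L ^ k) c x i : ℝ) ∧ (boxCoord hPd (P.L ^ k) c x i : ℝ) + R₀ ≤ (P.L ^ k * M0 i : ℕ) - 1 := by
  have hval := val_bounds_of_mem_blockK hk hx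
  constructor
  · rw [mem_cubeT_iff_val hPd hfit]
    intro μ
    obtain ⟨h1, h2⟩ := hval μ
    obtain ⟨h3, h4⟩ := hdeepB μ
    constructor
    · have : ((c (Fin.cast hPd μ) * P.L ^ k : ℕ) : ℝ) ≤ (x μ).val := by push_cast; linarith
      exact_mod_cast this
    · have : ((x μ).val : ℝ) < ((c (Fin.cast hPd μ) * P.L ^ k + P.L ^ k * M0 (Fin.cast hPd μ) : ℕ) : ℝ) := by push_cast; linarith
      exact_mod_cast this
  · intro i
    obtain ⟨h1, h2⟩ := hval (Fin.cast hPd.symm i)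
    obtain ⟨h3, h4⟩ := hdeepB (Fin.cast hPd.symm i)
    rw [cast_cast hPd] at h3 h4
    have hb : (boxCoord hPd (P.L ^ k) c x i : ℝ) = ((x (Fin.cast hPd.symm i)).val : ℝ) - ((c i * P.L ^ k : ℕ) : ℝ) := by
      simp only [boxCoord]; push_cast; ring
    rw [hb]
    push_cast
    constructor <;> linarith

end RowHyps

/-! ## §4 The multiplicity `#S`: the labels active on the rows of one `k`-block (print's *"at most 2^d terms"*, summed over a block) -/

section Multiplicity

/-- **the label box of a range of midpoint-sums**: the labels `α` with `α_i ∈ [⌊lo_i/m⌋, ⌊hi_i/m⌋ + 1]` for every `i` — where the `2^{d+1}`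
candidate labels (p38's `cand m σ`: `α_i ∈ {⌊σ_i/m⌋, ⌊σ_i/m⌋ + 1}`) of every `σ` with `lo ≤ σ ≤ hi` lie. [cite: BalabanImbrieJaffe1988, (2.27) p.263] -/
def labelBox (m : ℕ) (lo hi : Fin (d + 1) → ℝ) : Finset (Fin (d + 1) → ℤ) :=
  Fintype.piFinset fun i => Finset.Icc ⌊lo i / m⌋ (⌊hi i / m⌋ + 1)

/-- the candidate labels of a midpoint-sum in the range lie in the label box. [cite: BalabanImbrieJaffe1988, (2.27) p.263] -/
theorem mem_labelBox_of_mem_cand {m : ℕ} (hm : 0 < m) {lo hi : Fin (d + 1) → ℝ} {σ α : Fin (d + 1) → ℤ}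
    (hσ : ∀ i, lo i ≤ (σ i : ℝ) ∧ (σ i : ℝ) ≤ hi i) (hα : α ∈ cand m σ) : α ∈ labelBox m lo hi := by
  rw [labelBox, Fintype.mem_piFinset]
  rw [cand, Fintype.mem_piFinset] at hα
  intro i
  have hmr : (0 : ℝ) < m := by exact_mod_cast hm
  have h1 : ⌊lo i / m⌋ ≤ ⌊(σ i : ℝ) / m⌋ := Int.floor_le_floor (div_le_div_of_nonneg_right (hσ i).1 hmr.le)
  have h2 : ⌊(σ i : ℝ) / m⌋ ≤ ⌊hi i / m⌋ := Int.floor_le_floor (div_le_div_of_nonneg_right (hσ i).2 hmr.le)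
  have hαi := hα i
  rw [Finset.mem_insert, Finset.mem_singleton] at hαi
  rw [Finset.mem_Icc]
  rcases hαi with h | h <;> rw [h] <;> constructor <;> omega

/-- **the size of a label box**: if every side of the range has length `≤ ℓ`, the box holds at most `(⌊ℓ/m⌋ + 3)^{d+1}` labels.
[cite: BalabanImbrieJaffe1988, (2.27) p.263] -/
theorem card_labelBox_le {m : ℕ} (hm : 0 < m) {lo hi : Fin (d + 1) → ℝ} {ℓ : ℝ} (hℓ : 0 ≤ ℓ) (h : ∀ i, hi i - lo i ≤ ℓ) :
    (labelBox m lo hi).card ≤ (⌊ℓ / m⌋₊ + 3) ^ (d + 1) := by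
  rw [labelBox, Fintype.card_piFinset]
  have hmr : (0 : ℝ) < m := by exact_mod_cast hm
  have hfac : ∀ i, (Finset.Icc ⌊lo i / m⌋ (⌊hi i / m⌋ + 1)).card ≤ ⌊ℓ / m⌋₊ + 3 := by
    intro i
    rw [Int.card_Icc, Int.toNat_le]
    have e : hi i / m = lo i / m + (hi i - lo i) / m := by ring
    have h1 : ⌊hi i / m⌋ - 1 ≤ ⌊lo i / m⌋ + ⌊(hi i - lo i) / m⌋ := by rw [e]; exact Int.le_floor_add_floor _ _
    have h2 : ⌊(hi i - lo i) / m⌋ ≤ ⌊ℓ / m⌋ := Int.floor_le_floor (div_le_div_of_nonneg_right (h i) hmr.le)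
    have h3 : ((⌊ℓ / m⌋₊ : ℕ) : ℤ) = ⌊ℓ / m⌋ := Int.natCast_floor_eq_floor (div_nonneg hℓ hmr.le)
    push_cast
    rw [h3]
    omega
  calc ∏ i, (Finset.Icc ⌊lo i / m⌋ (⌊hi i / m⌋ + 1)).card ≤ ∏ _i : Fin (d + 1), (⌊ℓ / m⌋₊ + 3) :=
        Finset.prod_le_prod' fun i _ => hfac i
    _ = (⌊ℓ / m⌋₊ + 3) ^ (d + 1) := by rw [Finset.prod_const, Finset.card_univ, Fintype.card_fin]

variable (hPd : P.d = d + 1) (n : ℕ) (c : Fin (d + 1) → ℕ) (s : ℕ) (R₀ : ℝ)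

/-- the chart coordinate (relative to the corner of `Ω₀`) of the corner of the `k`-block of `y₁ ∈ T^{(k)}`: `n·(y₁)_i − c_i·n`, `n = L^k`.
[cite: BalabanImbrieJaffe1985, (2.4) p.302, dictionary] -/
def blockBase {k : ℕ} (y₁ : Balaban1983to89.Site P (0 + k)) : Fin (d + 1) → ℝ :=
  fun i => (n : ℝ) * (y₁ (Fin.cast hPd.symm i)).val - (c i : ℝ) * n

/-- **the labels that can be active on the rows of the `k`-block of `y₁`** (for a cut-off of range `R₀`): the label box of the midpoint-sums
`σ = z_x + z_y`, `x` in the block, `y` within `R₀` of `x` in every chart coordinate — `σ_i ∈ [2·base_i − R₀, 2·base_i + 2n − 2 + R₀]`.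
[cite: BalabanImbrieJaffe1988, (2.27) p.263] -/
def activeLabels {k : ℕ} (y₁ : Balaban1983to89.Site P (0 + k)) : Finset (Fin (d + 1) → ℤ) :=
  labelBox (2 * s) (fun i => 2 * blockBase hPd n c y₁ i - R₀) fun i => 2 * blockBase hPd n c y₁ i + 2 * n - 2 + R₀

variable {hPd n c s R₀}

/-- **`#S ≤ (⌊(n − 1 + R₀)/s⌋ + 3)^{d+1}`**: the number of labels active on the rows of one `k`-block (`n = L^k ≥ 1`, cut-off range `R₀ ≥ 0`,
cube spacing `s ≥ 1`). [cite: BalabanImbrieJaffe1988, (2.27) p.263] -/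
theorem card_activeLabels_le (hn : 1 ≤ n) (hs : 0 < s) (hR₀ : 0 ≤ R₀) {k : ℕ} (y₁ : Balaban1983to89.Site P (0 + k)) :
    (activeLabels hPd n c s R₀ y₁).card ≤ (⌊((n : ℝ) - 1 + R₀) / s⌋₊ + 3) ^ (d + 1) := by
  have hn1 : (1 : ℝ) ≤ n := by exact_mod_cast hn
  have hℓ : (0 : ℝ) ≤ 2 * n - 2 + 2 * R₀ := by linarith
  have h := card_labelBox_le (d := d) (m := 2 * s) (by omega) hℓ
    (lo := fun i => 2 * blockBase hPd n c y₁ i - R₀) (hi := fun i => 2 * blockBase hPd n c y₁ i + 2 * n - 2 + R₀)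
    (fun i => by linarith)
  have e : (2 * (n : ℝ) - 2 + 2 * R₀) / ((2 * s : ℕ) : ℝ) = ((n : ℝ) - 1 + R₀) / s := by
    rw [show (2 * (n : ℝ) - 2 + 2 * R₀) = 2 * ((n : ℝ) - 1 + R₀) by ring, show ((2 * s : ℕ) : ℝ) = 2 * (s : ℝ) by push_cast; ring,
      mul_div_mul_left _ _ (two_ne_zero)]
  rw [e] at h
  exact h

/-- **`#S ≤ 3^{d+1}` when the cube spacing dominates a block plus the cut-off range, `s ≥ n + R₀`** (the printed regime: cubes of side
`(1/2L)r(e_{k−1})·L^k ≫ L^k + (1/4L)r(e_{k−1})·…`; at most three grid labels per direction are seen from one block). [cite: BalabanImbrieJaffe1988, (2.27) p.263] -/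
theorem card_activeLabels_le_three_pow (hn : 1 ≤ n) (hs : 0 < s) (hR₀ : 0 ≤ R₀) (hbig : (n : ℝ) + R₀ ≤ s) {k : ℕ}
    (y₁ : Balaban1983to89.Site P (0 + k)) : (activeLabels hPd n c s R₀ y₁).card ≤ 3 ^ (d + 1) := by
  have h := card_activeLabels_le (hPd := hPd) (c := c) hn hs hR₀ y₁
  have hsr : (0 : ℝ) < s := by exact_mod_cast hs
  have h0 : ⌊((n : ℝ) - 1 + R₀) / s⌋₊ = 0 := by
    rw [Nat.floor_eq_zero, div_lt_one hsr]; linarith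
  rwa [h0, zero_add] at h

/-- **the core of the multiplicity count**: a candidate label of the midpoint-sum of a row point `x ∈ B^k(y₁)` and a point `y` whose chart
coordinates are within `R₀` of those of `x` belongs to `activeLabels`. [cite: BalabanImbrieJaffe1988, (2.27) p.263] -/
theorem mem_activeLabels_of_mem_cand {k : ℕ} (hk : 0 + k ≤ P.m + P.K) (hs : 0 < s) {y₁ : Balaban1983to89.Site P (0 + k)}
    {x : Balaban1983to89.Site P 0} (hx : x ∈ blockK k y₁) {α : Fin (d + 1) → ℤ} {y : Balaban1983to89.Site P 0}
    (hcand : α ∈ cand (2 * s) (boxCoord hPd (P.L ^ k) c x + boxCoord hPd (P.L ^ k) c y))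
    (hclose : ∀ i, ((|boxCoord hPd (P.L ^ k) c x i - boxCoord hPd (P.L ^ k) c y i| : ℤ) : ℝ) ≤ R₀) :
    α ∈ activeLabels hPd (P.L ^ k) c s R₀ y₁ := by
  have hval := val_bounds_of_mem_blockK hk hx
  refine mem_labelBox_of_mem_cand (by omega) (fun i => ?_) hcand
  set μ := Fin.cast hPd.symm i with hμ
  have hd := abs_le.1 (by rw [← cast_abs_sub]; exact hclose i :
    |(boxCoord hPd (P.L ^ k) c x i : ℝ) - (boxCoord hPd (P.L ^ k) c y i : ℝ)| ≤ R₀)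
  obtain ⟨h1, h2⟩ := hval μ
  have hb : (boxCoord hPd (P.L ^ k) c x i : ℝ) = ((x μ).val : ℝ) - (c i : ℝ) * ((P.L ^ k : ℕ) : ℝ) := by
    simp only [boxCoord, hμ]; push_cast; ring
  have hcast : ((P.L ^ k : ℕ) : ℝ) = (P.L : ℝ) ^ k := by push_cast; rfl
  simp only [blockBase, Pi.add_apply, Int.cast_add, ← hμ]
  rw [hcast] at hb ⊢
  constructor <;> linarith

/-- **Every label active on a row of the block belongs to `activeLabels`** — the hypothesis `hS` of p31's `decay236_flat_level` for the torus
data, for ANY cut-off vanishing beyond sup-torus distance `R₀`, given the torus gap `L^k·M₀_i + R₀ ≤ |T^{(0)}|` (no depth condition on the block: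
the weights vanish outside `Ω₀`, and inside `Ω₀` torus-closeness is chart-closeness by the gap). [cite: BalabanImbrieJaffe1988, (2.27) p.263] -/
theorem mem_activeLabels_of_ne_zero {M0 : Fin (d + 1) → ℕ} {k : ℕ} (hk : 0 + k ≤ P.m + P.K) (hs : 0 < s)
    (hfit : ∀ i, c i * P.L ^ k + P.L ^ k * M0 i ≤ P.sitesPerDir 0) (hgap₀ : ∀ i, ((P.L ^ k * M0 i : ℕ) : ℝ) + R₀ ≤ P.sitesPerDir 0)
    {ζ'' : Balaban1983to89.Site P 0 → Balaban1983to89.Site P 0 → ℝ} (hζ : ∀ x y, R₀ ≤ B5Ineq137Torus.T P 0 x y → ζ'' x y = 0)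
    {y₁ : Balaban1983to89.Site P (0 + k)} {x : Balaban1983to89.Site P 0} (hx : x ∈ blockK k y₁) {α : Fin (d + 1) → ℤ}
    {y : Balaban1983to89.Site P 0} (hne : ζ'' x y * lamT hPd (P.L ^ k) c M0 s α x y ≠ 0) :
    α ∈ activeLabels hPd (P.L ^ k) c s R₀ y₁ := by
  have hN : 1 ≤ P.sitesPerDir 0 := (P.one_lt_sitesPerDir 0).le
  have hζne : ζ'' x y ≠ 0 := left_ne_zero_of_mul hne
  have hlne : lamT hPd (P.L ^ k) c M0 s α x y ≠ 0 := right_ne_zero_of_mul hne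
  obtain ⟨hxΩ, hyΩ⟩ := mem_of_lamT_ne_zero hlne
  rw [lamT_of_mem α hxΩ hyΩ] at hlne
  have hcand : α ∈ cand (2 * s) (boxCoord hPd (P.L ^ k) c x + boxCoord hPd (P.L ^ k) c y) := by
    by_contra h
    exact hlne (BIJ88ConvexWeights227.cwt_eq_zero_of_not_mem_cand h)
  have hT : B5Ineq137Torus.T P 0 x y < R₀ := lt_of_not_ge fun h => hζne (hζ x y h)
  refine mem_activeLabels_of_mem_cand hk hs hx hcand fun i => ?_
  obtain ⟨hx0, hx1⟩ := boxCoord_bounds hPd hfit hxΩ i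
  obtain ⟨hy0, hy1⟩ := boxCoord_bounds hPd hfit hyΩ i
  have habs : |boxCoord hPd (P.L ^ k) c x i - boxCoord hPd (P.L ^ k) c y i| ≤ ((P.L ^ k * M0 i : ℕ) : ℤ) - 1 := by
    rw [abs_le]; constructor <;> omega
  have habs' : ((|boxCoord hPd (P.L ^ k) c x i - boxCoord hPd (P.L ^ k) c y i| : ℤ) : ℝ) ≤ ((P.L ^ k * M0 i : ℕ) : ℝ) - 1 := by
    exact_mod_cast habs
  refine (abs_lt_of_circAbs_lt hN ?_ (by linarith [hgap₀ i])).le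
  rw [boxCoord_sub_boxCoord hPd]
  exact lt_of_le_of_lt (circAbs_le_T x y _) hT

/-- **Every label active on a row of a block DEEP INSIDE `Ω₀` belongs to `activeLabels`** — the hypothesis `hS` of p31's `close235_flat_level`
for the torus data (no gap condition: the active `y` is within `R₀` of the deep `x` in the chart by `mem_and_abs_sub_le_of_T_le`).
[cite: BalabanImbrieJaffe1988, (2.27) p.263] -/
theorem mem_activeLabels_of_ne_zero_of_deep {M0 : Fin (d + 1) → ℕ} {k : ℕ} (hk : 0 + k ≤ P.m + P.K) (hs : 0 < s)
    (hfit : ∀ i, c i * P.L ^ k + P.L ^ k * M0 i ≤ P.sitesPerDir 0)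
    {ζ'' : Balaban1983to89.Site P 0 → Balaban1983to89.Site P 0 → ℝ} (hζ : ∀ x y, R₀ ≤ B5Ineq137Torus.T P 0 x y → ζ'' x y = 0)
    {y₁ : Balaban1983to89.Site P (0 + k)} {x : Balaban1983to89.Site P 0} (hx : x ∈ blockK k y₁)
    (hdeep : ∀ i, R₀ ≤ (boxCoord hPd (P.L ^ k) c x i : ℝ) ∧ (boxCoord hPd (P.L ^ k) c x i : ℝ) + R₀ ≤ (P.L ^ k * M0 i : ℕ) - 1)
    {α : Fin (d + 1) → ℤ} {y : Balaban1983to89.Site P 0} (hne : ζ'' x y * lamT hPd (P.L ^ k) c M0 s α x y ≠ 0) :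
    α ∈ activeLabels hPd (P.L ^ k) c s R₀ y₁ := by
  have hζne : ζ'' x y ≠ 0 := left_ne_zero_of_mul hne
  have hlne : lamT hPd (P.L ^ k) c M0 s α x y ≠ 0 := right_ne_zero_of_mul hne
  obtain ⟨hxΩ, hyΩ⟩ := mem_of_lamT_ne_zero hlne
  rw [lamT_of_mem α hxΩ hyΩ] at hlne
  have hcand : α ∈ cand (2 * s) (boxCoord hPd (P.L ^ k) c x + boxCoord hPd (P.L ^ k) c y) := by
    by_contra h
    exact hlne (BIJ88ConvexWeights227.cwt_eq_zero_of_not_mem_cand h)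
  have hT : B5Ineq137Torus.T P 0 x y ≤ R₀ := le_of_lt (lt_of_not_ge fun h => hζne (hζ x y h))
  exact mem_activeLabels_of_mem_cand hk hs hx hcand (mem_and_abs_sub_le_of_T_le hPd hfit hdeep hT).2

end Multiplicity

/-! ## §5 (2.31), (2.35), (2.36) at flat backgrounds FOR THE TORUS DATA — p31's theorems with their data hypotheses discharged -/

section Consequences

variable (hPd : P.d = d + 1) (n : ℕ) (c M0 : Fin (d + 1) → ℕ) (s W : ℕ)

/-- **the cube family `{□_α}` of (2.27) on the torus**, indexed by the finite label set. [cite: BalabanImbrieJaffe1988, (2.27) p.263] -/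
abbrev cubeFam : ↥(labels n M0 s) → Finset (Balaban1983to89.Site P 0) := fun α => cubeOf hPd n c M0 s W α.1

/-- **the weight family `{λ_α}` of (2.27) on the torus**, indexed by the finite label set. [cite: BalabanImbrieJaffe1988, (2.27) p.263] -/
abbrev lamFam : ↥(labels n M0 s) → Balaban1983to89.Site P 0 → Balaban1983to89.Site P 0 → ℝ := fun α => lamT hPd n c M0 s α.1

variable {hPd n c M0 s W}

/-- the data hypothesis `hcube` of p31's nested theorems for the torus cube family. [cite: BalabanImbrieJaffe1988, (2.27) p.263] -/
theorem cubeFam_nested (hM0 : ∀ i, 1 ≤ M0 i) (α : ↥(labels n M0 s)) :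
    ∃ t M : Fin (d + 1) → ℕ, (∀ i, 1 ≤ M i) ∧ (∀ i, t i + M i ≤ M0 i) ∧
      cubeFam hPd n c M0 s W α = cubeT hPd n (c + t) fun i => n * M i :=
  cubeOf_nested hM0 α.1

/-- the data hypothesis `hcube` of p31's `decay236_flat_level` (cubes fitting in the torus, each on its own) for the torus cube family.
[cite: BalabanImbrieJaffe1988, (2.27) p.263] -/
theorem cubeFam_fits (hM0 : ∀ i, 1 ≤ M0 i) (hfit : ∀ i, c i * n + n * M0 i ≤ P.sitesPerDir 0)
    (hN0 : ∀ i, n * M0 i < P.sitesPerDir 0) (α : ↥(labels n M0 s)) :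
    ∃ c' M : Fin (d + 1) → ℕ, (∀ i, 1 ≤ M i) ∧ (∀ i, c' i * n + n * M i ≤ P.sitesPerDir 0) ∧ (∀ i, n * M i < P.sitesPerDir 0) ∧
      cubeFam hPd n c M0 s W α = cubeT hPd n c' fun i => n * M i :=
  ⟨c + tLo n M0 s W α.1, fun i => tHi n M0 s W α.1 i - tLo n M0 s W α.1 i, one_le_tHi_sub_tLo hM0 α.1,
    fit_of_nested (tLo_add_le α.1) hfit, short_of_nested (tLo_add_le α.1) hN0, rfl⟩

/-- **(2.31), KERNEL FORM, AT FLAT BACKGROUNDS FOR THE PRINTED DATA** (p31's `close231_flat_kernel_level` with its data hypotheses (i)–(iii)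
discharged by §3): there are `δ₀, c₀ > 0` depending on `(d, ℓ, a)` only such that for every volume, every `1 ≤ k ≤ K`, every no-wrap box
`Ω₀ = c·L^k + Π_i[0, L^k·M₀_i)` leaving a torus gap `≥ R`, every cube spacing `s ≥ 1` and half-width `W ≥ 2s/3 + R₀/2 + R`, radii
`0 ≤ R`, `0 ≤ R₁ < R₀`, every pure gauge `h` and every fine site `x ∈ Ω₀` of chart depth `≥ R₀`:
`|G_{k,loc}(1^h; x, y) − G_k(Ω₀, 1^h; x, y)| ≤ (L^kε)²·c₀(e^{−2δ₀R/L^k} + e^{−(δ₀/2)R₁/L^k})·e^{−(δ₀/2)|x−y|_T/L^k}` for all `y`, where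
`G_{k,loc}` is built from the torus cubes `{□_α}`, the weights `λ_α` of (2.27) and the cut-off `ζ″` of (2.29) constructed above.
[cite: BalabanImbrieJaffe1988, (2.31) p.263] -/
theorem close231_flat_kernel_cwt (d ℓ : ℕ) (hℓ : 1 ≤ ℓ) {a : ℝ} (ha : 0 < a) :
    ∃ δ₀ c₀ : ℝ, 0 < δ₀ ∧ 0 < c₀ ∧ ∀ (P : Params) (hPd : P.d = d + 1), P.L = ℓ + 1 →
      ∀ k : ℕ, 1 ≤ k → k ≤ P.K → ∀ (c M0 : Fin (d + 1) → ℕ), (∀ i, 1 ≤ M0 i) →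
        (∀ i, c i * P.L ^ k + P.L ^ k * M0 i ≤ P.sitesPerDir 0) → (∀ i, P.L ^ k * M0 i < P.sitesPerDir 0) →
      ∀ (s W : ℕ), 1 ≤ s → ∀ (R R₀ R₁ : ℝ), 0 ≤ R → 0 ≤ R₁ → R₁ < R₀ → 2 * (s : ℝ) / 3 + R₀ / 2 + R ≤ W →
        (∀ i, ((P.L ^ k * M0 i : ℕ) : ℝ) + R ≤ P.sitesPerDir 0) →
      ∀ (h : GaugeTransf P 0 U1) (x : Balaban1983to89.Site P 0), x ∈ (cubeT hPd (P.L ^ k) c fun i => P.L ^ k * M0 i) →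
        (∀ i, R₀ ≤ (boxCoord hPd (P.L ^ k) c x i : ℝ) ∧ (boxCoord hPd (P.L ^ k) c x i : ℝ) + R₀ ≤ (P.L ^ k * M0 i : ℕ) - 1) →
      ∀ y : Balaban1983to89.Site P 0,
        ‖gLocT (B1RG242Torus.α P a k * (P.L : ℝ) ^ (k * P.d)) P.eps⁻¹ (gaugeAct h (1 : GaugeField P 0 U1)) k
              (cubeFam hPd (P.L ^ k) c M0 s W) (lamFam hPd (P.L ^ k) c M0 s) (cutoff R₁ R₀ (B5Ineq137Torus.T P 0)) x y -
            gBox (B1RG242Torus.α P a k * (P.L : ℝ) ^ (k * P.d)) P.eps⁻¹ (gaugeAct h (1 : GaugeField P 0 U1)) k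
              (cubeT hPd (P.L ^ k) c fun i => P.L ^ k * M0 i) x y‖ ≤
          P.spacing k ^ 2 * (c₀ * (Real.exp (-(δ₀ * (((P.L : ℝ) ^ k)⁻¹ * (2 * R)))) + Real.exp (-(δ₀ / 2 * (((P.L : ℝ) ^ k)⁻¹ * R₁)))) *
            Real.exp (-(δ₀ / 2 * (((P.L : ℝ) ^ k)⁻¹ * B5Ineq137Torus.T P 0 x y)))) := by
  obtain ⟨δ₀, c₀, hδ₀, hc₀, H⟩ := close231_flat_kernel_level d ℓ hℓ ha
  refine ⟨δ₀, c₀, hδ₀, hc₀, ?_⟩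
  intro P hPd hPL k hk1 hkK c M0 hM0 hfit0 hN0 s W hs R R₀ R₁ hR hR₁ hR10 hW hgap h x hx hdeep y
  have hn : 1 ≤ P.L ^ k := Nat.one_le_pow _ _ P.L_pos
  have hζ0 := cutoff_eq_zero_of_le (P := P) hR10
  exact H P hPd hPL k hk1 hkK c M0 hM0 hfit0 hN0 _ (cubeFam hPd (P.L ^ k) c M0 s W) (lamFam hPd (P.L ^ k) c M0 s)
    (cutoff R₁ R₀ (B5Ineq137Torus.T P 0)) (cubeFam_nested hM0) (sum_abs_lamT_le_one hfit0) (cutoff_mem_unitInterval R₁ R₀) h x R R₁ hR hR₁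
    (rowHyp_i hPd hfit0 hζ0 hx hdeep) (rowHyp_ii hPd hn hs hfit0 hR hgap hW hζ0 hx hdeep) (rowHyp_iii hR10 x) y

/-- kernel: `0 < A = α_k·L^{kd}` and `0 < a_k` (the normalization constants of p31's bounds). [cite: BalabanImbrieJaffe1988, (2.34) p.263] -/
private theorem A_pos (P : Params) {a : ℝ} (ha : 0 < a) {k : ℕ} (hk1 : 1 ≤ k) :
    0 < B1RG242Torus.α P a k * (P.L : ℝ) ^ (k * P.d) ∧ 0 < B1.aSeq a P.L k := by
  have hak : 0 < B1.aSeq a P.L k := B1.aSeq_pos ha (B1RG242Torus.one_lt_cast_L P) hk1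
  have hα : 0 < B1RG242Torus.α P a k := mul_pos hak (inv_pos.mpr (pow_pos (P.spacing_pos k) 2))
  exact ⟨mul_pos hα (pow_pos P.cast_L_pos _), hak⟩

/-- the active labels of a block as a finite set of indices of the label set, with its cardinality bound. [cite: BalabanImbrieJaffe1988, (2.27) p.263] -/
theorem card_subtype_activeLabels_le {R₀ : ℝ} {k : ℕ} (hn : 1 ≤ n) (hs : 0 < s) (hR₀ : 0 ≤ R₀) (y₁ : Balaban1983to89.Site P (0 + k)) :
    (((activeLabels hPd n c s R₀ y₁).subtype fun α => α ∈ labels n M0 s).card : ℝ) ≤ (⌊((n : ℝ) - 1 + R₀) / s⌋₊ + 3) ^ (d + 1) := by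
  have h1 : ((activeLabels hPd n c s R₀ y₁).subtype fun α => α ∈ labels n M0 s).card ≤ (activeLabels hPd n c s R₀ y₁).card := by
    rw [Finset.card_subtype]; exact Finset.card_filter_le _ _
  exact_mod_cast h1.trans (card_activeLabels_le hn hs hR₀ y₁)

/-- **(2.35) AT FLAT BACKGROUNDS FOR THE PRINTED DATA** (p31's `close235_flat_level` with its data hypotheses (i)–(iii) discharged by §3 and the
multiplicity `#S` bounded by §4): there are `δ₀, c₀ > 0` depending on `(d, ℓ, a)` only such that for every volume, every `1 ≤ k ≤ K`, every no-wrap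
box `Ω₀` leaving a torus gap `≥ R`, every cube spacing `s ≥ 1` and half-width `W ≥ 2s/3 + R₀/2 + R`, radii `0 ≤ R`, `0 ≤ R₁ < R₀`, every pure
gauge `h`, every `k`-block site `y₁` whose block lies inside `Ω₀` with chart margin `R₀` (the printed *"dist({x₁,x₂},Ω^c) > O(r(e_k))"*) and every
`y₂`: `|Δ_{k,loc}(1^h; y₁, y₂) − Δ_k(Ω₀, 1^h; y₁, y₂)| ≤ A·a_kc₀(m·e^{−2δ₀R/L^k} + e^{−(δ₀/2)R₁/L^k})·e^{−(δ₀/2)|y₁−y₂|_{T^{(k)}}}`,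
`m = (⌊(L^k − 1 + R₀)/s⌋ + 3)^{d+1}` (`= 3^{d+1}` for `s ≥ L^k + R₀`, `card_activeLabels_le_three_pow`), `A = α_kL^{kd}` the counting normalization
of p31's file (the printed kernel is `(a_k/A)·deltaLocT`).  At the printed radii `R, R₁ ~ r(e_k)L^k` the bracket is `e^{−cr(e_k)}`.
[cite: BalabanImbrieJaffe1988, (2.35) p.263] -/
theorem close235_flat_cwt (d ℓ : ℕ) (hℓ : 1 ≤ ℓ) {a : ℝ} (ha : 0 < a) :
    ∃ δ₀ c₀ : ℝ, 0 < δ₀ ∧ 0 < c₀ ∧ ∀ (P : Params) (hPd : P.d = d + 1), P.L = ℓ + 1 →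
      ∀ k : ℕ, 1 ≤ k → k ≤ P.K → ∀ (c M0 : Fin (d + 1) → ℕ), (∀ i, 1 ≤ M0 i) →
        (∀ i, c i * P.L ^ k + P.L ^ k * M0 i ≤ P.sitesPerDir 0) → (∀ i, P.L ^ k * M0 i < P.sitesPerDir 0) →
      ∀ (s W : ℕ), 1 ≤ s → ∀ (R R₀ R₁ : ℝ), 0 ≤ R → 0 ≤ R₁ → R₁ < R₀ → 2 * (s : ℝ) / 3 + R₀ / 2 + R ≤ W →
        (∀ i, ((P.L ^ k * M0 i : ℕ) : ℝ) + R ≤ P.sitesPerDir 0) →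
      ∀ (h : GaugeTransf P 0 U1) (y₁ y₂ : Balaban1983to89.Site P (0 + k)),
        (∀ μ, (c (Fin.cast hPd μ) : ℝ) * P.L ^ k + R₀ ≤ (P.L : ℝ) ^ k * (y₁ μ).val ∧
          (P.L : ℝ) ^ k * (y₁ μ).val + P.L ^ k + R₀ ≤ (c (Fin.cast hPd μ) : ℝ) * P.L ^ k + (P.L : ℝ) ^ k * M0 (Fin.cast hPd μ)) →
        ‖deltaLocT (B1RG242Torus.α P a k * (P.L : ℝ) ^ (k * P.d)) P.eps⁻¹ (gaugeAct h (1 : GaugeField P 0 U1)) k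
              (cubeFam hPd (P.L ^ k) c M0 s W) (lamFam hPd (P.L ^ k) c M0 s) (cutoff R₁ R₀ (B5Ineq137Torus.T P 0)) y₁ y₂ -
            deltaRegion (B1RG242Torus.α P a k * (P.L : ℝ) ^ (k * P.d)) P.eps⁻¹ (gaugeAct h (1 : GaugeField P 0 U1)) k
              (cubeT hPd (P.L ^ k) c fun i => P.L ^ k * M0 i) y₁ y₂‖ ≤
          (B1RG242Torus.α P a k * (P.L : ℝ) ^ (k * P.d)) * (B1.aSeq a P.L k * c₀ *
            ((⌊(((P.L : ℝ) ^ k) - 1 + R₀) / s⌋₊ + 3) ^ (d + 1) * Real.exp (-(δ₀ * (((P.L : ℝ) ^ k)⁻¹ * (2 * R)))) +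
              Real.exp (-(δ₀ / 2 * (((P.L : ℝ) ^ k)⁻¹ * R₁)))) *
              Real.exp (-(δ₀ / 2 * (B5Ineq137Torus.T P (0 + k) y₁ y₂)))) := by
  obtain ⟨δ₀, c₀, hδ₀, hc₀, H⟩ := close235_flat_level d ℓ hℓ ha
  refine ⟨δ₀, c₀, hδ₀, hc₀, ?_⟩
  intro P hPd hPL k hk1 hkK c M0 hM0 hfit0 hN0 s W hs R R₀ R₁ hR hR₁ hR10 hW hgap h y₁ y₂ hdeepB
  have hn : 1 ≤ P.L ^ k := Nat.one_le_pow _ _ P.L_pos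
  have hk : 0 + k ≤ P.m + P.K := by omega
  have hR₀ : 0 ≤ R₀ := hR₁.trans hR10.le
  have hζ0 := cutoff_eq_zero_of_le (P := P) hR10
  have hxdeep := fun x (hx : x ∈ blockK k y₁) => mem_and_depth_of_mem_blockK hPd hk hfit0 hR₀ hdeepB hx
  set S : Finset ↥(labels (P.L ^ k) M0 s) := (activeLabels hPd (P.L ^ k) c s R₀ y₁).subtype fun α => α ∈ labels (P.L ^ k) M0 s
    with hSdef
  have hS : ∀ x ∈ blockK k y₁, ∀ (α : ↥(labels (P.L ^ k) M0 s)) (y : Balaban1983to89.Site P 0),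
      cutoff R₁ R₀ (B5Ineq137Torus.T P 0) x y * lamFam hPd (P.L ^ k) c M0 s α x y ≠ 0 → α ∈ S := by
    intro x hx α y hne
    rw [hSdef, Finset.mem_subtype]
    exact mem_activeLabels_of_ne_zero_of_deep hk hs hfit0 hζ0 hx (hxdeep x hx).2 hne
  have hB := H P hPd hPL k hk1 hkK c M0 hM0 hfit0 hN0 _ (cubeFam hPd (P.L ^ k) c M0 s W) (lamFam hPd (P.L ^ k) c M0 s)
    (cutoff R₁ R₀ (B5Ineq137Torus.T P 0)) (cubeFam_nested hM0) (sum_abs_lamT_le_one hfit0) (cutoff_mem_unitInterval R₁ R₀) h R R₁ hR hR₁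
    y₁ y₂ (fun x hx => rowHyp_i hPd hfit0 hζ0 (hxdeep x hx).1 (hxdeep x hx).2)
    (fun x hx => rowHyp_ii hPd hn hs hfit0 hR hgap hW hζ0 (hxdeep x hx).1 (hxdeep x hx).2) (fun x _ => rowHyp_iii hR10 x) S hS
  refine hB.trans ?_
  obtain ⟨hA, hak⟩ := A_pos P ha hk1
  have hcard : (S.card : ℝ) ≤ (⌊(((P.L : ℝ) ^ k) - 1 + R₀) / s⌋₊ + 3) ^ (d + 1) := by
    have h1 := card_subtype_activeLabels_le (hPd := hPd) (c := c) (M0 := M0) hn hs hR₀ y₁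
    have e : (((P.L ^ k : ℕ) : ℕ) : ℝ) = (P.L : ℝ) ^ k := by push_cast; rfl
    rw [hSdef]
    rw [e] at h1
    exact h1
  have hE1 := (Real.exp_pos (-(δ₀ * (((P.L : ℝ) ^ k)⁻¹ * (2 * R))))).le
  have hE3 := (Real.exp_pos (-(δ₀ / 2 * (B5Ineq137Torus.T P (0 + k) y₁ y₂)))).le
  refine mul_le_mul_of_nonneg_left ?_ hA.le
  refine mul_le_mul_of_nonneg_right ?_ hE3
  refine mul_le_mul_of_nonneg_left ?_ (mul_pos hak hc₀).le
  exact add_le_add (mul_le_mul_of_nonneg_right hcard hE1) le_rfl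

/-- **(2.36) AT FLAT BACKGROUNDS FOR THE PRINTED DATA** (p31's `decay236_flat_level` with the multiplicity `#S` bounded by §4): there are
`δ₀, c₀ > 0` depending on `(d, ℓ, a)` only such that for every volume, every `1 ≤ k ≤ K`, every no-wrap box `Ω₀` leaving a torus gap `≥ R₀`,
every cube spacing `s ≥ 1`, half-width `W`, radii `0 ≤ R₁ < R₀`, every pure gauge `h` and ALL `k`-block sites `y₁, y₂`:
`|Δ_{k,loc}(1^h; y₁, y₂)| ≤ A·([y₁ = y₂] + m·a_kc₀e^{−δ₀|y₁−y₂|_{T^{(k)}}})`, `m = (⌊(L^k − 1 + R₀)/s⌋ + 3)^{d+1}` (`= 3^{d+1}` for `s ≥ L^k + R₀`),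
`A = α_kL^{kd}` (diagonal term kept separate, as in p31's file). [cite: BalabanImbrieJaffe1988, (2.36) p.263] -/
theorem decay236_flat_cwt (d ℓ : ℕ) (hℓ : 1 ≤ ℓ) {a : ℝ} (ha : 0 < a) :
    ∃ δ₀ c₀ : ℝ, 0 < δ₀ ∧ 0 < c₀ ∧ ∀ (P : Params) (hPd : P.d = d + 1), P.L = ℓ + 1 →
      ∀ k : ℕ, 1 ≤ k → k ≤ P.K → ∀ (c M0 : Fin (d + 1) → ℕ), (∀ i, 1 ≤ M0 i) →
        (∀ i, c i * P.L ^ k + P.L ^ k * M0 i ≤ P.sitesPerDir 0) → (∀ i, P.L ^ k * M0 i < P.sitesPerDir 0) →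
      ∀ (s W : ℕ), 1 ≤ s → ∀ (R₀ R₁ : ℝ), 0 ≤ R₁ → R₁ < R₀ → (∀ i, ((P.L ^ k * M0 i : ℕ) : ℝ) + R₀ ≤ P.sitesPerDir 0) →
      ∀ (h : GaugeTransf P 0 U1) (y₁ y₂ : Balaban1983to89.Site P (0 + k)),
        ‖deltaLocT (B1RG242Torus.α P a k * (P.L : ℝ) ^ (k * P.d)) P.eps⁻¹ (gaugeAct h (1 : GaugeField P 0 U1)) k
            (cubeFam hPd (P.L ^ k) c M0 s W) (lamFam hPd (P.L ^ k) c M0 s) (cutoff R₁ R₀ (B5Ineq137Torus.T P 0)) y₁ y₂‖ ≤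
          (B1RG242Torus.α P a k * (P.L : ℝ) ^ (k * P.d)) *
            ((if y₁ = y₂ then 1 else 0) +
              (⌊(((P.L : ℝ) ^ k) - 1 + R₀) / s⌋₊ + 3) ^ (d + 1) * B1.aSeq a P.L k * c₀ *
                Real.exp (-(δ₀ * (B5Ineq137Torus.T P (0 + k) y₁ y₂)))) := by
  obtain ⟨δ₀, c₀, hδ₀, hc₀, H⟩ := decay236_flat_level d ℓ hℓ ha
  refine ⟨δ₀, c₀, hδ₀, hc₀, ?_⟩
  intro P hPd hPL k hk1 hkK c M0 hM0 hfit0 hN0 s W hs R₀ R₁ hR₁ hR10 hgap₀ h y₁ y₂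
  have hn : 1 ≤ P.L ^ k := Nat.one_le_pow _ _ P.L_pos
  have hk : 0 + k ≤ P.m + P.K := by omega
  have hR₀ : 0 ≤ R₀ := hR₁.trans hR10.le
  have hζ0 := cutoff_eq_zero_of_le (P := P) hR10
  set S : Finset ↥(labels (P.L ^ k) M0 s) := (activeLabels hPd (P.L ^ k) c s R₀ y₁).subtype fun α => α ∈ labels (P.L ^ k) M0 s
    with hSdef
  have hS : ∀ x ∈ blockK k y₁, ∀ (α : ↥(labels (P.L ^ k) M0 s)) (y : Balaban1983to89.Site P 0),
      cutoff R₁ R₀ (B5Ineq137Torus.T P 0) x y * lamFam hPd (P.L ^ k) c M0 s α x y ≠ 0 → α ∈ S := by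
    intro x hx α y hne
    rw [hSdef, Finset.mem_subtype]
    exact mem_activeLabels_of_ne_zero hk hs hfit0 hgap₀ hζ0 hx hne
  have hζabs : ∀ x y : Balaban1983to89.Site P 0, |cutoff R₁ R₀ (B5Ineq137Torus.T P 0) x y| ≤ 1 := fun x y => by
    rw [abs_of_nonneg (cutoff_nonneg _ _ _ _ _)]; exact cutoff_le_one _ _ _ _ _
  have hB := H P hPd hPL k hk1 hkK _ (cubeFam hPd (P.L ^ k) c M0 s W) (lamFam hPd (P.L ^ k) c M0 s)
    (cutoff R₁ R₀ (B5Ineq137Torus.T P 0)) (cubeFam_fits hM0 hfit0 hN0) (sum_abs_lamT_le_one hfit0) hζabs h y₁ y₂ S hS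
  refine hB.trans ?_
  obtain ⟨hA, hak⟩ := A_pos P ha hk1
  have hcard : (S.card : ℝ) ≤ (⌊(((P.L : ℝ) ^ k) - 1 + R₀) / s⌋₊ + 3) ^ (d + 1) := by
    have h1 := card_subtype_activeLabels_le (hPd := hPd) (c := c) (M0 := M0) hn hs hR₀ y₁
    have e : (((P.L ^ k : ℕ) : ℕ) : ℝ) = (P.L : ℝ) ^ k := by push_cast; rfl
    rw [hSdef]
    rw [e] at h1
    exact h1
  have hE := (Real.exp_pos (-(δ₀ * (B5Ineq137Torus.T P (0 + k) y₁ y₂)))).le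
  refine mul_le_mul_of_nonneg_left (add_le_add le_rfl ?_) hA.le
  have : (S.card : ℝ) * B1.aSeq a P.L k * c₀ * Real.exp (-(δ₀ * (B5Ineq137Torus.T P (0 + k) y₁ y₂))) =
      (S.card : ℝ) * (B1.aSeq a P.L k * c₀ * Real.exp (-(δ₀ * (B5Ineq137Torus.T P (0 + k) y₁ y₂)))) := by ring
  have e2 : ((⌊(((P.L : ℝ) ^ k) - 1 + R₀) / s⌋₊ : ℝ) + 3) ^ (d + 1) * B1.aSeq a P.L k * c₀ *
      Real.exp (-(δ₀ * (B5Ineq137Torus.T P (0 + k) y₁ y₂))) = ((⌊(((P.L : ℝ) ^ k) - 1 + R₀) / s⌋₊ : ℝ) + 3) ^ (d + 1) *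
      (B1.aSeq a P.L k * c₀ * Real.exp (-(δ₀ * (B5Ineq137Torus.T P (0 + k) y₁ y₂)))) := by ring
  rw [this, e2]
  exact mul_le_mul_of_nonneg_right hcard (by positivity)

end Consequences

/-! ## §6 Non-vacuity: every hypothesis of `close235_flat_cwt` met at once on a genuine `Setup.Params` torus -/

section Instance

/-- The parameters of the instance: `d = 1`, `L = 3` (odd, as `Setup` requires), `m = 1`, `K = 3` — `2·3⁴ = 162` fine sites, `54` sites of
`T^{(1)}`. [cite: Balaban1987RG1, (0.1) p.251] -/
private abbrev P3 : Params := { d := 1, L := 3, m := 1, K := 3, hd := le_rfl, hL := ⟨⟨1, rfl⟩, by norm_num⟩ }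

/-- `|T^{(0)}| = 162`. [cite: Balaban1987RG1, (0.1) p.251] -/
private theorem sites_P3 : P3.sitesPerDir 0 = 162 := by decide

/-- `|T^{(1)}| = 54`. [cite: Balaban1987RG1, (0.1) p.251] -/
private theorem sites_P3_1 : P3.sitesPerDir (0 + 1) = 54 := by decide

/-- **THE HYPOTHESES OF `close235_flat_cwt` ARE JOINTLY SATISFIABLE** (so (2.35) for the torus data is not a statement about the empty set):
on the `Setup` torus `ℤ/162` (`d = 1`, `L = 3`), at `k = 1`, box `Ω₀ = [0, 12)` (`c = 0`, `M₀ = 4`), cube spacing `s = 1`, half-width `W = 2`,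
radii `R = 0`, `R₁ = 0`, `R₀ = 1`, and the `1`-block site `y₁ = 1 ∈ ℤ/54` (block `[3, 6)`, chart margin `1` inside `[0, 12)`), every displayed
hypothesis holds; consequently the (2.35) bound of `close235_flat_cwt` applies there for every pure gauge `h` and every `y₂`, with the
multiplicity `(⌊(3 − 1 + 1)/1⌋ + 3)^1 = 6`. [cite: BalabanImbrieJaffe1988, (2.35) p.263] -/
theorem close235_flat_cwt_instance :
    ∃ δ₀ c₀ : ℝ, 0 < δ₀ ∧ 0 < c₀ ∧ ∀ (h : GaugeTransf P3 0 U1) (y₂ : Balaban1983to89.Site P3 (0 + 1)),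
      ‖deltaLocT (B1RG242Torus.α P3 1 1 * (P3.L : ℝ) ^ (1 * P3.d)) P3.eps⁻¹ (gaugeAct h (1 : GaugeField P3 0 U1)) 1
            (cubeFam (d := 0) rfl (P3.L ^ 1) (fun _ => 0) (fun _ => 4) 1 2) (lamFam (d := 0) rfl (P3.L ^ 1) (fun _ => 0) (fun _ => 4) 1)
            (cutoff 0 1 (B5Ineq137Torus.T P3 0)) (fun _ => 1) y₂ -
          deltaRegion (B1RG242Torus.α P3 1 1 * (P3.L : ℝ) ^ (1 * P3.d)) P3.eps⁻¹ (gaugeAct h (1 : GaugeField P3 0 U1)) 1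
            (cubeT (d := 0) rfl (P3.L ^ 1) (fun _ => 0) fun _ => P3.L ^ 1 * 4) (fun _ => 1) y₂‖ ≤
        (B1RG242Torus.α P3 1 1 * (P3.L : ℝ) ^ (1 * P3.d)) * (B1.aSeq 1 P3.L 1 * c₀ *
          ((⌊(((P3.L : ℝ) ^ 1) - 1 + 1) / (1 : ℕ)⌋₊ + 3) ^ (0 + 1) * Real.exp (-(δ₀ * (((P3.L : ℝ) ^ 1)⁻¹ * (2 * 0)))) +
            Real.exp (-(δ₀ / 2 * (((P3.L : ℝ) ^ 1)⁻¹ * 0)))) *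
            Real.exp (-(δ₀ / 2 * (B5Ineq137Torus.T P3 (0 + 1) (fun _ => 1) y₂)))) := by
  obtain ⟨δ₀, c₀, hδ₀, hc₀, H⟩ := close235_flat_cwt 0 2 (by norm_num) one_pos
  refine ⟨δ₀, c₀, hδ₀, hc₀, fun h y₂ => ?_⟩
  have hv : ∀ μ : Fin P3.d, ((fun _ => 1 : Balaban1983to89.Site P3 (0 + 1)) μ).val = 1 := by
    intro μ
    show ZMod.val (1 : ZMod (P3.sitesPerDir (0 + 1))) = 1
    rw [sites_P3_1]; decide
  refine H P3 rfl rfl 1 le_rfl (by decide) (fun _ => 0) (fun _ => 4) (fun _ => by norm_num) (fun _ => by rw [sites_P3]; norm_num)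
    (fun _ => by rw [sites_P3]; norm_num) 1 2 le_rfl 0 1 0 le_rfl le_rfl one_pos (by norm_num) (fun _ => by rw [sites_P3]; norm_num) h
    (fun _ => 1) y₂ fun μ => ?_
  rw [hv μ]
  norm_num

end Instance

/-! ## §7 (v1.2, APPEND-ONLY) The kernel decay of (2.27)/(2.28) and the OPERATOR FORMS (2.30)/(2.31) at flat backgrounds FOR THE TORUS DATA -/

section OperatorForms

/-- kernel: the label of a fine site over its own `k`-block site (`x ∈ B^k(x^{(k)})`). [cite: BalabanImbrieJaffe1985, (2.4) p.302, dictionary] -/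
private theorem mem_blockK_blkIter {k : ℕ} (x : Balaban1983to89.Site P 0) : x ∈ blockK k (blkIter k x) :=
  mem_blockK.2 rfl

/-- **KERNEL DECAY OF (2.27) `G̃_k(1^h)` FOR THE PRINTED DATA** (p31's `decay_gTilde_flat_kernel_level` with its data hypotheses discharged:
the torus cubes `{□_α}` each fit in the torus, `Σ_α|λ_α| ≤ 1`): `‖G̃_k(1^h; x, y)‖ ≤ (L^kε)²·c₀e^{−δ₀|x−y|_T/L^k}` for ALL fine sites `x, y`,
constants from `(d, ℓ, a)` only. [cite: BalabanImbrieJaffe1988, (2.27) p.263] -/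
theorem decay_gTilde_flat_kernel_cwt (d ℓ : ℕ) (hℓ : 1 ≤ ℓ) {a : ℝ} (ha : 0 < a) :
    ∃ δ₀ c₀ : ℝ, 0 < δ₀ ∧ 0 < c₀ ∧ ∀ (P : Params) (hPd : P.d = d + 1), P.L = ℓ + 1 →
      ∀ k : ℕ, 1 ≤ k → k ≤ P.K → ∀ (c M0 : Fin (d + 1) → ℕ), (∀ i, 1 ≤ M0 i) →
        (∀ i, c i * P.L ^ k + P.L ^ k * M0 i ≤ P.sitesPerDir 0) → (∀ i, P.L ^ k * M0 i < P.sitesPerDir 0) →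
      ∀ (s W : ℕ) (h : GaugeTransf P 0 U1) (x y : Balaban1983to89.Site P 0),
        ‖BIJ88DeltaLoc234Torus.gTilde (B1RG242Torus.α P a k * (P.L : ℝ) ^ (k * P.d)) P.eps⁻¹ (gaugeAct h (1 : GaugeField P 0 U1)) k
            (cubeFam hPd (P.L ^ k) c M0 s W) (lamFam hPd (P.L ^ k) c M0 s) x y‖ ≤
          P.spacing k ^ 2 * (c₀ * Real.exp (-(δ₀ * (((P.L : ℝ) ^ k)⁻¹ * B5Ineq137Torus.T P 0 x y)))) := by
  obtain ⟨δ₀, c₀, hδ₀, hc₀, H⟩ := decay_gTilde_flat_kernel_level d ℓ hℓ ha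
  refine ⟨δ₀, c₀, hδ₀, hc₀, ?_⟩
  intro P hPd hPL k hk1 hkK c M0 hM0 hfit0 hN0 s W h x y
  exact H P hPd hPL k hk1 hkK _ (cubeFam hPd (P.L ^ k) c M0 s W) (lamFam hPd (P.L ^ k) c M0 s) (cubeFam_fits hM0 hfit0 hN0)
    (sum_abs_lamT_le_one hfit0) h x y

/-- **KERNEL DECAY OF (2.28) `G_{k,loc}(1^h) = ζ″G̃_k(1^h)` FOR THE PRINTED DATA** (p31's `decay_gLocT_flat_kernel_level`, data hypotheses
discharged; the cut-off of (2.29) is p13's `cutoff R₁ R₀ |·|_T`, `|ζ″| ≤ 1`): `‖G_{k,loc}(1^h; x, y)‖ ≤ (L^kε)²·c₀e^{−δ₀|x−y|_T/L^k}` for all `x, y`.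
[cite: BalabanImbrieJaffe1988, (2.28) p.263] -/
theorem decay_gLocT_flat_kernel_cwt (d ℓ : ℕ) (hℓ : 1 ≤ ℓ) {a : ℝ} (ha : 0 < a) :
    ∃ δ₀ c₀ : ℝ, 0 < δ₀ ∧ 0 < c₀ ∧ ∀ (P : Params) (hPd : P.d = d + 1), P.L = ℓ + 1 →
      ∀ k : ℕ, 1 ≤ k → k ≤ P.K → ∀ (c M0 : Fin (d + 1) → ℕ), (∀ i, 1 ≤ M0 i) →
        (∀ i, c i * P.L ^ k + P.L ^ k * M0 i ≤ P.sitesPerDir 0) → (∀ i, P.L ^ k * M0 i < P.sitesPerDir 0) →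
      ∀ (s W : ℕ) (R₀ R₁ : ℝ) (h : GaugeTransf P 0 U1) (x y : Balaban1983to89.Site P 0),
        ‖gLocT (B1RG242Torus.α P a k * (P.L : ℝ) ^ (k * P.d)) P.eps⁻¹ (gaugeAct h (1 : GaugeField P 0 U1)) k
            (cubeFam hPd (P.L ^ k) c M0 s W) (lamFam hPd (P.L ^ k) c M0 s) (cutoff R₁ R₀ (B5Ineq137Torus.T P 0)) x y‖ ≤
          P.spacing k ^ 2 * (c₀ * Real.exp (-(δ₀ * (((P.L : ℝ) ^ k)⁻¹ * B5Ineq137Torus.T P 0 x y)))) := by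
  obtain ⟨δ₀, c₀, hδ₀, hc₀, H⟩ := decay_gLocT_flat_kernel_level d ℓ hℓ ha
  refine ⟨δ₀, c₀, hδ₀, hc₀, ?_⟩
  intro P hPd hPL k hk1 hkK c M0 hM0 hfit0 hN0 s W R₀ R₁ h x y
  have hζabs : ∀ x y : Balaban1983to89.Site P 0, |cutoff R₁ R₀ (B5Ineq137Torus.T P 0) x y| ≤ 1 := fun x y => by
    rw [abs_of_nonneg (cutoff_nonneg _ _ _ _ _)]; exact cutoff_le_one _ _ _ _ _
  exact H P hPd hPL k hk1 hkK _ (cubeFam hPd (P.L ^ k) c M0 s W) (lamFam hPd (P.L ^ k) c M0 s) (cutoff R₁ R₀ (B5Ineq137Torus.T P 0))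
    (cubeFam_fits hM0 hfit0 hN0) (sum_abs_lamT_le_one hfit0) hζabs h x y

/-- **(2.30) AT FLAT BACKGROUNDS, OPERATOR FORM, FOR THE PRINTED DATA** (p31's `opDecay230_flat_level` with the data hypotheses discharged and
the multiplicity set of row `x` replaced by §4's count for the block of `x`): for every volume, `1 ≤ k ≤ K`, every no-wrap box `Ω₀` leaving a torus
gap `≥ R₀`, cube spacing `s ≥ 1`, half-width `W`, radii `0 ≤ R₁ < R₀`, every pure gauge `h`, EVERY fine row `x` and every `f` with `‖f‖_∞ ≤ F`
supported at sup-torus distance `≥ D` from `x`: `‖(G_{k,loc}(1^h)f)(x)‖ ≤ (L^kε)²·m·c₀e^{−δ₀D/L^k}·F`, `m = (⌊(L^k − 1 + R₀)/s⌋ + 3)^{d+1}` —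
the printed *"|(G_{k,loc}(u)f)(x)| ≦ ce^{−c dist(suppt f,x)}‖f‖_∞ (2.30)"* at `u = 1^h` for the printed localization.
[cite: BalabanImbrieJaffe1988, (2.30) p.263] -/
theorem opDecay230_flat_cwt (d ℓ : ℕ) (hℓ : 1 ≤ ℓ) {a : ℝ} (ha : 0 < a) :
    ∃ δ₀ c₀ : ℝ, 0 < δ₀ ∧ 0 < c₀ ∧ ∀ (P : Params) (hPd : P.d = d + 1), P.L = ℓ + 1 →
      ∀ k : ℕ, 1 ≤ k → k ≤ P.K → ∀ (c M0 : Fin (d + 1) → ℕ), (∀ i, 1 ≤ M0 i) →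
        (∀ i, c i * P.L ^ k + P.L ^ k * M0 i ≤ P.sitesPerDir 0) → (∀ i, P.L ^ k * M0 i < P.sitesPerDir 0) →
      ∀ (s W : ℕ), 1 ≤ s → ∀ (R₀ R₁ : ℝ), 0 ≤ R₁ → R₁ < R₀ → (∀ i, ((P.L ^ k * M0 i : ℕ) : ℝ) + R₀ ≤ P.sitesPerDir 0) →
      ∀ (h : GaugeTransf P 0 U1) (x : Balaban1983to89.Site P 0) (f : Balaban1983to89.Site P 0 → ℂ) (F D : ℝ),
        (∀ y, ‖f y‖ ≤ F) → (∀ y, f y ≠ 0 → D ≤ B5Ineq137Torus.T P 0 x y) →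
        ‖(gLocT (B1RG242Torus.α P a k * (P.L : ℝ) ^ (k * P.d)) P.eps⁻¹ (gaugeAct h (1 : GaugeField P 0 U1)) k
            (cubeFam hPd (P.L ^ k) c M0 s W) (lamFam hPd (P.L ^ k) c M0 s) (cutoff R₁ R₀ (B5Ineq137Torus.T P 0)) *ᵥ f) x‖ ≤
          P.spacing k ^ 2 * (((⌊(((P.L : ℝ) ^ k) - 1 + R₀) / s⌋₊ : ℝ) + 3) ^ (d + 1) *
            (c₀ * Real.exp (-(δ₀ * (((P.L : ℝ) ^ k)⁻¹ * D))) * F)) := by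
  obtain ⟨δ₀, c₀, hδ₀, hc₀, H⟩ := opDecay230_flat_level d ℓ hℓ ha
  refine ⟨δ₀, c₀, hδ₀, hc₀, ?_⟩
  intro P hPd hPL k hk1 hkK c M0 hM0 hfit0 hN0 s W hs R₀ R₁ hR₁ hR10 hgap₀ h x f F D hF hsupp
  have hn : 1 ≤ P.L ^ k := Nat.one_le_pow _ _ P.L_pos
  have hk : 0 + k ≤ P.m + P.K := by omega
  have hR₀ : 0 ≤ R₀ := hR₁.trans hR10.le
  have hζ0 := cutoff_eq_zero_of_le (P := P) hR10
  have hζabs : ∀ x y : Balaban1983to89.Site P 0, |cutoff R₁ R₀ (B5Ineq137Torus.T P 0) x y| ≤ 1 := fun x y => by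
    rw [abs_of_nonneg (cutoff_nonneg _ _ _ _ _)]; exact cutoff_le_one _ _ _ _ _
  have hF0 : 0 ≤ F := (norm_nonneg _).trans (hF x)
  set S : Finset ↥(labels (P.L ^ k) M0 s) := (activeLabels hPd (P.L ^ k) c s R₀ (blkIter k x)).subtype fun α => α ∈ labels (P.L ^ k) M0 s
    with hSdef
  have hS : ∀ (α : ↥(labels (P.L ^ k) M0 s)) (y : Balaban1983to89.Site P 0),
      cutoff R₁ R₀ (B5Ineq137Torus.T P 0) x y * lamFam hPd (P.L ^ k) c M0 s α x y ≠ 0 → f y ≠ 0 → α ∈ S := by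
    intro α y hne _
    rw [hSdef, Finset.mem_subtype]
    exact mem_activeLabels_of_ne_zero hk hs hfit0 hgap₀ hζ0 (mem_blockK_blkIter x) hne
  have hB := H P hPd hPL k hk1 hkK _ (cubeFam hPd (P.L ^ k) c M0 s W) (lamFam hPd (P.L ^ k) c M0 s) (cutoff R₁ R₀ (B5Ineq137Torus.T P 0))
    (cubeFam_fits hM0 hfit0 hN0) (sum_abs_lamT_le_one hfit0) hζabs h x f F D hF hsupp S hS
  refine hB.trans (mul_le_mul_of_nonneg_left (mul_le_mul_of_nonneg_right ?_ (by positivity)) (sq_nonneg _))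
  have h1 := card_subtype_activeLabels_le (hPd := hPd) (c := c) (M0 := M0) hn hs hR₀ (blkIter k x)
  have e : (((P.L ^ k : ℕ) : ℕ) : ℝ) = (P.L : ℝ) ^ k := by push_cast; rfl
  rw [hSdef]
  rw [e] at h1
  exact h1

/-- **(2.31) AT FLAT BACKGROUNDS, OPERATOR FORM, FOR THE PRINTED DATA** (p31's `opClose231_flat_level` with its row hypotheses (i)–(iii)
discharged by §3 and the multiplicity bounded by §4): for every volume, `1 ≤ k ≤ K`, every no-wrap box `Ω₀` leaving a torus gap `≥ R`, cube
spacing `s ≥ 1`, half-width `W ≥ 2s/3 + R₀/2 + R`, radii `0 ≤ R`, `0 ≤ R₁ < R₀`, every pure gauge `h`, every fine row `x ∈ Ω₀` of chart depth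
`≥ R₀` (the printed *"dist(x,Ω^c) ≧ O(r(e_k))"*) and every `f` with `‖f‖_∞ ≤ F` supported at sup-torus distance `≥ D ≥ 0` from `x`:
`‖(G_{k,loc}(1^h)f − G_k(Ω₀,1^h)f)(x)‖ ≤ (L^kε)²·c₀(m·e^{−2δ₀R/L^k} + e^{−(δ₀/2)R₁/L^k})·e^{−(δ₀/2)D/L^k}·F`, `m = (⌊(L^k − 1 + R₀)/s⌋ + 3)^{d+1}`
— the printed *"|(G_{k,loc}(u)f − G_k(Ω,u)f)(x)| ≦ e^{−cr(e_k)}e^{−c dist(suppt f,x)}‖f‖_∞ (2.31)"* at `u = 1^h` for the printed localization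
(bracket `= e^{−cr(e_k)}` at the printed radii `R, R₁ ~ r(e_k)L^k`). [cite: BalabanImbrieJaffe1988, (2.31) p.263] -/
theorem opClose231_flat_cwt (d ℓ : ℕ) (hℓ : 1 ≤ ℓ) {a : ℝ} (ha : 0 < a) :
    ∃ δ₀ c₀ : ℝ, 0 < δ₀ ∧ 0 < c₀ ∧ ∀ (P : Params) (hPd : P.d = d + 1), P.L = ℓ + 1 →
      ∀ k : ℕ, 1 ≤ k → k ≤ P.K → ∀ (c M0 : Fin (d + 1) → ℕ), (∀ i, 1 ≤ M0 i) →
        (∀ i, c i * P.L ^ k + P.L ^ k * M0 i ≤ P.sitesPerDir 0) → (∀ i, P.L ^ k * M0 i < P.sitesPerDir 0) →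
      ∀ (s W : ℕ), 1 ≤ s → ∀ (R R₀ R₁ : ℝ), 0 ≤ R → 0 ≤ R₁ → R₁ < R₀ → 2 * (s : ℝ) / 3 + R₀ / 2 + R ≤ W →
        (∀ i, ((P.L ^ k * M0 i : ℕ) : ℝ) + R ≤ P.sitesPerDir 0) →
      ∀ (h : GaugeTransf P 0 U1) (x : Balaban1983to89.Site P 0), x ∈ (cubeT hPd (P.L ^ k) c fun i => P.L ^ k * M0 i) →
        (∀ i, R₀ ≤ (boxCoord hPd (P.L ^ k) c x i : ℝ) ∧ (boxCoord hPd (P.L ^ k) c x i : ℝ) + R₀ ≤ (P.L ^ k * M0 i : ℕ) - 1) →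
      ∀ (f : Balaban1983to89.Site P 0 → ℂ) (F D : ℝ), (∀ y, ‖f y‖ ≤ F) → 0 ≤ D → (∀ y, f y ≠ 0 → D ≤ B5Ineq137Torus.T P 0 x y) →
        ‖(gLocT (B1RG242Torus.α P a k * (P.L : ℝ) ^ (k * P.d)) P.eps⁻¹ (gaugeAct h (1 : GaugeField P 0 U1)) k
              (cubeFam hPd (P.L ^ k) c M0 s W) (lamFam hPd (P.L ^ k) c M0 s) (cutoff R₁ R₀ (B5Ineq137Torus.T P 0)) *ᵥ f) x -
            (gBox (B1RG242Torus.α P a k * (P.L : ℝ) ^ (k * P.d)) P.eps⁻¹ (gaugeAct h (1 : GaugeField P 0 U1)) k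
              (cubeT hPd (P.L ^ k) c fun i => P.L ^ k * M0 i) *ᵥ f) x‖ ≤
          P.spacing k ^ 2 * (c₀ * (((⌊(((P.L : ℝ) ^ k) - 1 + R₀) / s⌋₊ : ℝ) + 3) ^ (d + 1) *
              Real.exp (-(δ₀ * (((P.L : ℝ) ^ k)⁻¹ * (2 * R)))) + Real.exp (-(δ₀ / 2 * (((P.L : ℝ) ^ k)⁻¹ * R₁)))) *
            Real.exp (-(δ₀ / 2 * (((P.L : ℝ) ^ k)⁻¹ * D))) * F) := by
  obtain ⟨δ₀, c₀, hδ₀, hc₀, H⟩ := opClose231_flat_level d ℓ hℓ ha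
  refine ⟨δ₀, c₀, hδ₀, hc₀, ?_⟩
  intro P hPd hPL k hk1 hkK c M0 hM0 hfit0 hN0 s W hs R R₀ R₁ hR hR₁ hR10 hW hgap h x hx hdeep f F D hF hD hsupp
  have hn : 1 ≤ P.L ^ k := Nat.one_le_pow _ _ P.L_pos
  have hk : 0 + k ≤ P.m + P.K := by omega
  have hR₀ : 0 ≤ R₀ := hR₁.trans hR10.le
  have hζ0 := cutoff_eq_zero_of_le (P := P) hR10
  have hF0 : 0 ≤ F := (norm_nonneg _).trans (hF x)
  set S : Finset ↥(labels (P.L ^ k) M0 s) := (activeLabels hPd (P.L ^ k) c s R₀ (blkIter k x)).subtype fun α => α ∈ labels (P.L ^ k) M0 s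
    with hSdef
  have hS : ∀ (α : ↥(labels (P.L ^ k) M0 s)) (y : Balaban1983to89.Site P 0),
      cutoff R₁ R₀ (B5Ineq137Torus.T P 0) x y * lamFam hPd (P.L ^ k) c M0 s α x y ≠ 0 → f y ≠ 0 → α ∈ S := by
    intro α y hne _
    rw [hSdef, Finset.mem_subtype]
    exact mem_activeLabels_of_ne_zero_of_deep hk hs hfit0 hζ0 (mem_blockK_blkIter x) hdeep hne
  have hB := H P hPd hPL k hk1 hkK c M0 hM0 hfit0 hN0 _ (cubeFam hPd (P.L ^ k) c M0 s W) (lamFam hPd (P.L ^ k) c M0 s)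
    (cutoff R₁ R₀ (B5Ineq137Torus.T P 0)) (cubeFam_nested hM0) (sum_abs_lamT_le_one hfit0) (cutoff_mem_unitInterval R₁ R₀) h x R R₁ hR hR₁
    (rowHyp_i hPd hfit0 hζ0 hx hdeep) (rowHyp_ii hPd hn hs hfit0 hR hgap hW hζ0 hx hdeep) (rowHyp_iii hR10 x) f F D hF hD hsupp S hS
  refine hB.trans ?_
  have hcard : (S.card : ℝ) ≤ (⌊(((P.L : ℝ) ^ k) - 1 + R₀) / s⌋₊ + 3) ^ (d + 1) := by
    have h1 := card_subtype_activeLabels_le (hPd := hPd) (c := c) (M0 := M0) hn hs hR₀ (blkIter k x)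
    have e : (((P.L ^ k : ℕ) : ℕ) : ℝ) = (P.L : ℝ) ^ k := by push_cast; rfl
    rw [hSdef]
    rw [e] at h1
    exact h1
  have hE1 := (Real.exp_pos (-(δ₀ * (((P.L : ℝ) ^ k)⁻¹ * (2 * R))))).le
  have hE2 := (Real.exp_pos (-(δ₀ / 2 * (((P.L : ℝ) ^ k)⁻¹ * D)))).le
  refine mul_le_mul_of_nonneg_left ?_ (sq_nonneg _)
  refine mul_le_mul_of_nonneg_right (mul_le_mul_of_nonneg_right (mul_le_mul_of_nonneg_left ?_ hc₀.le) hE2) hF0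
  exact add_le_add (mul_le_mul_of_nonneg_right hcard hE1) le_rfl

end OperatorForms

end

end Literature.MathematicalPhysics.QuantumFieldTheory.BalabanImbrieJaffe1984to88.BIJ88LocWeights227Torus
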